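import Literature.Analysis.FluidPDE.CaloricRemainderCalculus
import Literature.Analysis.FluidPDE.SuitableWeakPressure
import Literature.Analysis.FluidPDE.CaloricTestFieldCalculus
import Mathlib.MeasureTheory.Function.L2Space
import Mathlib.MeasureTheory.Function.LpSeminorm.CompareExp
import HarnessLib

/-!
# The local energy inequality of the caloric remainder `w = u - e` of a suitable weak solution

Analysis/FluidPDE proof file (theorems only, no new definitions or named facts) on the
Calderón / Rusin–Šverák route to the far-field regularity of Kato's mild `L³` solution near the
blow-up time (`Literature.Analysis.FluidPDE.IsKatoSolutionOn.farField_bound`,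
`RusinSverakSingularPoint.lean`): W. Rusin, V. Šverák, *Minimal initial data for potential
Navier–Stokes singularities*, J. Funct. Anal. 260 (2011) = arXiv:0911.0500, §4 p. 6 ("we write
`u = a + v` [...] `v` satisfies the local energy inequality [...] the assumptions of
Proposition 2.1 are satisfied for `(u, p)` and `Q_{z₀,r}`, `z₀ = (x₀, T)`, `|x₀| > R`");
C. P. Calderón, Trans. AMS 318 (1990) 179–200, §1 (splitting of the datum, energy estimates for
the remainder); P. G. Lemarié-Rieusset, *The Navier–Stokes problem in the 21st century* (2016),
proof of Thm. 14.7, pp. 515–516: for a suitable (local Leray) solution `u₂` and a regular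
solution `u₁`, "due to the suitability of `u₂` and the regularity of `u₁`" one has the three
balances for `|u₁|²/2`, `u₁·u₂`, `|u₂|²/2`, "whence
`∂ₜ(|w|²/2) = νΔ(|w|²/2) - ν|∇w|² - div(q w) - A - μ`" for the difference `w`.

## The statement

Let `(u, p)` be a distributional solution of the unforced Navier–Stokes equations on an open
`Ω ⊆ ℝ × E` with a weak spatial gradient `G ∈ L²_loc(Ω)` satisfying the Caffarelli–Kohn–Nirenberg
local energy inequality (the data of `IsSuitableWeakSolutionOn.localEnergy`), with
`u ∈ L³_loc(Ω)` and `p ∈ L^{3/2}_loc(Ω)`; let `e : ℝ → E → E` be a globally smooth,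
divergence-free space–time field solving the heat equation `∂ₜe = νΔe` on `Ω` (in the
application: the caloric extension `e^{νtΔ}u(t₁)` of a bounded slice of the Kato solution,
smoothly cut off in time), and let `φ ∈ C_c^∞(Ω)`, `φ ≥ 0`. Then, with `w = u - e` and
`∇w = G - De` (`caloric_remainder_local_energy_inequality`):

  `2ν ∫∫ |∇w|² φ ≤ ∫∫ |w|² (φₜ + νΔφ) + ∫∫ (|w|² - |e|²) u·∇φ + 2 ∫∫ p w·∇φ - 2 ∫∫ φ ⟪De(u), u⟫`.

This is exactly Lemarié-Rieusset's display with `u₁ = e` (`𝔽 = 0`, the "pressure" of the caloric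
flow being zero) written against a test function: the transport term `div(|w|² u /2)`-type
contributions are `(|w|² - |e|²) u·∇φ`, the pressure term is `2 p w·∇φ`, and the coupling
`A = w·((w·∇)u₁)`-type term appears in the un-expanded form `⟪De(u), u⟫ φ` (its expansion
`(u ⊗ u):∇e = (w ⊗ w):∇e + w·(e·∇)e + (u·∇)|e|²/2 + …`, with the cancellations coming from
`div u = div e = 0`, is carried out in the sequel file where the Grönwall argument is run).

## The proof ("three balances")

All integrals are first taken over `ℝ × E` (the integrands are supported in the compact
`K = tsupport φ ⊆ Ω`, on which `u ∈ L³`, `p ∈ L^{3/2}`, `G ∈ L²` and all weights are bounded):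
* (LEI) suitability: `2ν ∫∫ |G|²φ ≤ ∫∫ |u|²(φₜ + νΔφ) + ∫∫ (|u|² + 2p) u·∇φ`;
* (NS) the momentum equation tested with `ψ = φ e ∈ C_c^∞(Ω; E)`
  (`IsSpaceTimeTestOn.smul_field`): with `∂ₜψ = φₜ e + νφ Δe`, `(u·∇)ψ = (u·∇φ) e + φ De(u)`,
  `Δψ = φΔe + 2De(∇φ) + (Δφ)e`, `div ψ = e·∇φ`,
  `∫∫ φₜ ⟪u,e⟫ + 2ν ∫∫ φ⟪u,Δe⟫ + ∫∫ (u·∇φ)⟪u,e⟫ + ∫∫ φ⟪De(u),u⟫ + ν ∫∫ Δφ⟪u,e⟫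
   + 2ν ∫∫ ⟪u, De(∇φ)⟫ + ∫∫ p e·∇φ = 0`;
* (WG) the weak-gradient identity tested with `φ ⟪De(·) bᵢ, bⱼ⟫` and summed over an orthonormal
  basis: `∫∫ φ ⟪G, De⟫_F = -∫∫ φ ⟪u, Δe⟫ - ∫∫ ⟪u, De(∇φ)⟫`;
* (HEAT) the classical identity `∫∫ |e|²φₜ + ν∫∫ |e|²Δφ = 2ν ∫∫ |De|²φ`
  (`caloric_local_energy_identity`);
and the pointwise expansions `|G - De|² = |G|² - 2⟪G, De⟫_F + |De|²`,
`|u - e|² = |u|² - 2⟪u, e⟫ + |e|²`; the conclusion is the linear combination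
`(LEI) - 4ν(WG) - 2(NS) + (HEAT)`.

## Mathlib / tree search

Tree: `IsDistributionalNSSolutionOn`, `HasWeakSpatialGradientOn`, `IsSuitableWeakSolutionOn`
(`SuitableWeak.lean`, `WeakSolution.lean`); `integrable_inner_of_locallyIntegrableOn`,
`integrable_mul_of_locallyIntegrableOn`, `IsSpaceTimeTestOn.continuous_gradient_field`
(`SuitableWeakPressure.lean`); `IsSpaceTimeTestOn.mul_smooth` (`CaloricTestFieldCalculus.lean`);
`caloric_local_energy_identity`, `IsSpaceTimeTestOn.smul_field`, `timeDeriv_smul_field`,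
`convect_smul_field`, `divergence_smul_field`, `laplacian_smul_field`,
`sum_fderiv_smul_fderiv_eq` (`CaloricRemainderCalculus.lean`); `laplacian_eq_sum_fderiv_fderiv`,
`norm_apply_sq_le_frobeniusNormSq`, `frobeniusNormSq_eq_sum` (`WholeSpaceIBP.lean`,
`VectorCalculus.lean`). Mathlib: `integral_prod`, `integrableOn_iff_integrable_of_support_subset`,
`Integrable.mono'`, `MemLp.mul'`, `memLp_two_iff_integrable_sq_norm`,
`OrthonormalBasis.sum_inner_mul_inner`, `norm_sub_sq_real`.

## References

* W. Rusin, V. Šverák, J. Funct. Anal. 260 (2011) 879–891 = arXiv:0911.0500, §4 p. 6.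
  [RusinSverak2011]
* C. P. Calderón, *Existence of weak solutions for the Navier–Stokes equations with initial data
  in `Lᵖ`*, Trans. Amer. Math. Soc. 318 (1990) 179–200, §1. [Calderon1990]
* P. G. Lemarié-Rieusset, *The Navier–Stokes problem in the 21st century*, CRC Press 2016,
  Thm. 14.7, proof pp. 515–516; Prop. 15.1. [LemarieRieusset2016]
* L. Caffarelli, R. Kohn, L. Nirenberg, Comm. Pure Appl. Math. 35 (1982), §2 (2.1)–(2.5).
  [CaffarelliKohnNirenberg1982]
-/

noncomputable section

open MeasureTheory TopologicalSpace Set Function Filter Topology InnerProductSpace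
open scoped RealInnerProductSpace ENNReal NNReal Laplacian

namespace Literature.Analysis.FluidPDE

variable {E : Type*} [NormedAddCommGroup E] [InnerProductSpace ℝ E] [FiniteDimensional ℝ E]
  [MeasurableSpace E] [BorelSpace E]

/-! ### Integrability tools on a compact set -/

section Tools

/-- **Domination on a compact set.** A function supported in a compact `K`, a.e.-strongly
measurable on `K` and dominated on `K` by an integrable function, is integrable on the whole
space–time. [folklore] -/
theorem integrable_of_bound_on_compact {K : Set (ℝ × E)} (hK : IsCompact K)
    {F' : Type*} [NormedAddCommGroup F'] {F : ℝ × E → F'} {g : ℝ × E → ℝ}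
    (hg : IntegrableOn g K volume) (hFm : AEStronglyMeasurable F (volume.restrict K))
    (hF0 : ∀ z ∉ K, F z = 0) (hle : ∀ z ∈ K, ‖F z‖ ≤ g z) : Integrable F volume := by
  have hsupp : support F ⊆ K := fun z hz => by
    by_contra h
    exact hz (hF0 z h)
  refine (integrableOn_iff_integrable_of_support_subset hsupp).1 ?_
  exact Integrable.mono' hg hFm ((ae_restrict_iff' hK.measurableSet).2 (Eventually.of_forall hle))

omit [InnerProductSpace ℝ E] [FiniteDimensional ℝ E] [MeasurableSpace E] [BorelSpace E] in
/-- A continuous function on `ℝ × E` is bounded on a compact set (by a nonnegative constant). [folklore] -/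
theorem exists_forall_mem_norm_le_of_continuous {K : Set (ℝ × E)} (hK : IsCompact K)
    {F' : Type*} [NormedAddCommGroup F'] {f : ℝ × E → F'} (hf : Continuous f) :
    ∃ C : ℝ, 0 ≤ C ∧ ∀ z ∈ K, ‖f z‖ ≤ C := by
  obtain ⟨C, hC⟩ := hK.exists_bound_of_continuousOn hf.continuousOn
  exact ⟨max C 0, le_max_right _ _, fun z hz => (hC z hz).trans (le_max_left _ _)⟩

end Tools

/-! ### The local energy inequality of the remainder -/

section Main

variable {Ω : Opens (ℝ × E)} {ν : ℝ} {u e : ℝ → E → E} {p : ℝ → E → ℝ}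
  {G : ℝ → E → E →L[ℝ] E} {φ : ℝ → E → ℝ}

set_option maxHeartbeats 1600000 in
/-- **Local energy inequality of the caloric remainder** (Rusin–Šverák 2011, §4 p. 6, the local
energy inequality of `v = u - a`; Lemarié-Rieusset 2016, proof of Thm. 14.7, pp. 515–516, "the
three balances for `|u₁|²/2`, `u₁·u₂`, `|u₂|²/2`", here with the regular field `u₁ = e` a smooth
divergence-free solution of the heat equation). Let `(u, p)` solve the unforced Navier–Stokes
equations in the sense of distributions on the open `Ω ⊆ ℝ × E`, with a weak spatial gradient
`G ∈ L²_loc(Ω)` for which the Caffarelli–Kohn–Nirenberg local energy inequality holds (the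
content of `IsSuitableWeakSolutionOn.localEnergy`), `u ∈ L³_loc(Ω)`, `p ∈ L^{3/2}_loc(Ω)`; let
`e` be jointly smooth with `∂ₜe = νΔe` on `Ω` and `div e(t) = 0` for all `t`; let
`φ ∈ C_c^∞(Ω)`, `φ ≥ 0`. Then (iterated integrals over `ℝ` and `E`, `∇w := G - De`, `w := u - e`)
`2ν ∫∫ |∇w|² φ ≤ ∫∫ |w|²(φₜ + νΔφ) + ∫∫ (|w|² - |e|²) u·∇φ + 2 ∫∫ p w·∇φ - 2 ∫∫ φ ⟪De(u), u⟫`.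
[cite: LemarieRieusset2016, Thm. 14.7, proof pp. 515–516] [cite: RusinSverak2011, §4 p. 6] -/
theorem caloric_remainder_local_energy_inequality
    (hNS : IsDistributionalNSSolutionOn Ω ν 0 u p)
    (hG : HasWeakSpatialGradientOn Ω u G)
    (hG2 : ∀ K ⊆ (Ω : Set (ℝ × E)), IsCompact K →
      ∫⁻ z in K, ENNReal.ofReal (frobeniusNormSq (G z.1 z.2)) < ∞)
    (hLEI : ∀ φ : ℝ → E → ℝ, IsSpaceTimeTestOn Ω φ → (∀ t x, 0 ≤ φ t x) →
      2 * ν * ∫ t, ∫ x, frobeniusNormSq (G t x) * φ t x ≤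
        ∫ t, ∫ x, (‖u t x‖ ^ 2 * (timeDeriv φ t x + ν * Δ (φ t) x) +
          (‖u t x‖ ^ 2 + 2 * p t x) * ⟪u t x, gradient (φ t) x⟫ +
          2 * ⟪(0 : ℝ → E → E) t x, u t x⟫ * φ t x))
    (hu3 : ∀ K ⊆ (Ω : Set (ℝ × E)), IsCompact K → MemLp (uncurry u) 3 (volume.restrict K))
    (hp32 : ∀ K ⊆ (Ω : Set (ℝ × E)), IsCompact K → MemLp (uncurry p) (3 / 2) (volume.restrict K))
    (he : ContDiff ℝ (⊤ : ℕ∞) (uncurry e))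
    (hheat : ∀ z ∈ (Ω : Set (ℝ × E)), HasDerivAt (fun s => e s z.2) (ν • (Δ (e z.1)) z.2) z.1)
    (hdiv : ∀ t, VectorCalculus.IsDivFree (e t))
    (hφ : IsSpaceTimeTestOn Ω φ) (hφ0 : ∀ t x, 0 ≤ φ t x) :
    2 * ν * ∫ t, ∫ x, frobeniusNormSq (G t x - fderiv ℝ (e t) x) * φ t x ≤
      (∫ t, ∫ x, ‖u t x - e t x‖ ^ 2 * (timeDeriv φ t x + ν * Δ (φ t) x)) +
        (∫ t, ∫ x, (‖u t x - e t x‖ ^ 2 - ‖e t x‖ ^ 2) * ⟪u t x, gradient (φ t) x⟫) +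
        2 * (∫ t, ∫ x, p t x * ⟪u t x - e t x, gradient (φ t) x⟫) -
        2 * ∫ t, ∫ x, φ t x * ⟪fderiv ℝ (e t) x (u t x), u t x⟫ := by
  haveI : (volume : Measure (ℝ × E)).IsAddHaarMeasure := Measure.prod.instIsAddHaarMeasure _ _
  haveI hHT31 : ENNReal.HolderTriple (3 / 2) 3 1 := by
    refine ⟨?_⟩
    rw [ENNReal.inv_div (Or.inr (by norm_num)) (Or.inr (by norm_num)), inv_one,
      show (3 : ℝ≥0∞)⁻¹ = 1 / 3 by rw [one_div], ENNReal.div_add_div_same,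
      show (2 : ℝ≥0∞) + 1 = 3 by norm_num, ENNReal.div_self (by norm_num) (by norm_num)]
  set b := stdOrthonormalBasis ℝ E with hb
  -- ### (0) smoothness and continuity of the weights
  have hes : IsSmoothSpaceTimeOn univ e := IsSmoothSpaceTimeOn.of_contDiff_univ he
  have hφs : IsSmoothSpaceTimeOn univ φ := hφ.isSmoothSpaceTimeOn univ
  have he_c : Continuous fun z : ℝ × E => e z.1 z.2 := hes.continuous_of_univ
  have hφ_c : Continuous fun z : ℝ × E => φ z.1 z.2 := hφs.continuous_of_univ
  have hLe_c : Continuous fun z : ℝ × E => (Δ (e z.1)) z.2 :=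
    (hes.laplacian uniqueDiffOn_univ).continuous_of_univ
  have hLφ_c : Continuous fun z : ℝ × E => (Δ (φ z.1)) z.2 :=
    (hφs.laplacian uniqueDiffOn_univ).continuous_of_univ
  have hDes : IsSmoothSpaceTimeOn univ fun t x => fderiv ℝ (e t) x := hes.fderiv_slice uniqueDiffOn_univ
  have hDe_c : Continuous fun z : ℝ × E => fderiv ℝ (e z.1) z.2 := hDes.continuous_of_univ
  have hgφ_c : Continuous fun z : ℝ × E => gradient (φ z.1) z.2 :=
    (hφs.gradient uniqueDiffOn_univ).continuous_of_univ
  have hφt_c : Continuous fun z : ℝ × E => timeDeriv φ z.1 z.2 := hφ.continuous_timeDeriv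
  have hfrob_c : Continuous fun L : E →L[ℝ] E => frobeniusNormSq L := by
    have : (fun L : E →L[ℝ] E => frobeniusNormSq L) = fun L => ∑ i, ‖L (b i)‖ ^ 2 :=
      funext fun L => frobeniusNormSq_eq_sum b L
    rw [this]
    exact continuous_finsetSum _ fun i _ =>
      ((ContinuousLinearMap.apply ℝ E (b i)).continuous.norm).pow 2
  have he2 : ∀ t, ContDiff ℝ 2 (e t) := fun t => contDiff_infty.1 (contDiff_slice_field (F := E) he t) 2
  have he1 : ∀ t, ContDiff ℝ 1 (e t) := fun t => (he2 t).of_le one_le_two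
  have hed : ∀ t x, DifferentiableAt ℝ (e t) x := fun t x => (he1 t).differentiable one_ne_zero x
  have hφ2 : ∀ t, ContDiff ℝ 2 (φ t) := fun t => contDiff_infty.1 (hφ.contDiff_slice t) 2
  have hφd : ∀ t x, DifferentiableAt ℝ (φ t) x := fun t x =>
    ((hφ2 t).differentiable (by norm_num)) x
  -- ### (1) the support and the classes of `u`, `p`, `G` on it
  set K : Set (ℝ × E) := tsupport (uncurry φ) with hK
  have hKc : IsCompact K := hφ.hasCompactSupport
  have hKΩ : K ⊆ (Ω : Set (ℝ × E)) := hφ.tsupport_subset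
  have hKm : MeasurableSet K := hKc.measurableSet
  haveI hKfin : IsFiniteMeasure (volume.restrict K) := ⟨by
    rw [Measure.restrict_apply_univ]; exact hKc.measure_lt_top⟩
  have hφK : ∀ z : ℝ × E, z ∉ K → φ z.1 z.2 = 0 := fun z hz =>
    image_eq_zero_of_notMem_tsupport (f := uncurry φ) hz
  have hφtK : ∀ z : ℝ × E, z ∉ K → timeDeriv φ z.1 z.2 = 0 := fun z hz =>
    IsSpaceTimeTestOn.timeDeriv_eq_zero_of_notMem hz
  have hnear : ∀ z : ℝ × E, z ∉ K → φ z.1 =ᶠ[𝓝 z.2] fun _ => (0 : ℝ) := fun z hz => by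
    have h0 : uncurry φ =ᶠ[𝓝 (z.1, z.2)] 0 := notMem_tsupport_iff_eventuallyEq.1 hz
    have hc : Continuous fun y : E => (z.1, y) := continuous_const.prodMk continuous_id
    exact (hc.tendsto z.2).eventually h0
  have hgφK : ∀ z : ℝ × E, z ∉ K → gradient (φ z.1) z.2 = 0 := fun z hz => by
    rw [gradient, (hnear z hz).fderiv_eq, fderiv_fun_const, Pi.zero_apply, map_zero]
  have hLφK : ∀ z : ℝ × E, z ∉ K → (Δ (φ z.1)) z.2 = 0 := fun z hz => by
    rw [(InnerProductSpace.laplacian_congr_nhds (hnear z hz)).self_of_nhds,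
      InnerProductSpace.laplacian_const, Pi.zero_apply]
  -- the classes
  have huK : MemLp (uncurry u) 3 (volume.restrict K) := hu3 K hKΩ hKc
  have hpK : MemLp (uncurry p) (3 / 2) (volume.restrict K) := hp32 K hKΩ hKc
  have hum : AEStronglyMeasurable (uncurry u) (volume.restrict K) := huK.aestronglyMeasurable
  have hpm : AEStronglyMeasurable (uncurry p) (volume.restrict K) := hpK.aestronglyMeasurable
  have hGm : AEStronglyMeasurable (uncurry G) (volume.restrict K) :=
    (hG.locallyIntegrableOn_grad.aestronglyMeasurable).mono_measure (Measure.restrict_mono hKΩ le_rfl)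
  have hum' : AEStronglyMeasurable (fun z : ℝ × E => u z.1 z.2) (volume.restrict K) := hum
  have hpm' : AEStronglyMeasurable (fun z : ℝ × E => p z.1 z.2) (volume.restrict K) := hpm
  have hGm' : AEStronglyMeasurable (fun z : ℝ × E => G z.1 z.2) (volume.restrict K) := hGm
  have hu2K : MemLp (uncurry u) 2 (volume.restrict K) := huK.mono_exponent (by norm_num)
  -- integrable dominating functions on `K`
  have gU2 : IntegrableOn (fun z : ℝ × E => ‖u z.1 z.2‖ ^ 2) K volume :=
    hu2K.integrable_norm_pow two_ne_zero
  have gU3 : IntegrableOn (fun z : ℝ × E => ‖u z.1 z.2‖ ^ 3) K volume :=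
    huK.integrable_norm_pow (by norm_num)
  have gU1 : IntegrableOn (fun z : ℝ × E => ‖u z.1 z.2‖) K volume :=
    (huK.integrable (by norm_num)).norm
  have h1le32 : (1 : ℝ≥0∞) ≤ 3 / 2 := by
    rw [ENNReal.le_div_iff_mul_le (Or.inl (by norm_num)) (Or.inl (by norm_num))]
    norm_num
  have gP1 : IntegrableOn (fun z : ℝ × E => ‖p z.1 z.2‖) K volume :=
    (hpK.integrable h1le32).norm
  have gPU : IntegrableOn (fun z : ℝ × E => ‖p z.1 z.2‖ * ‖u z.1 z.2‖) K volume := by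
    have h := MemLp.mul' (r := 1) (f := fun z : ℝ × E => ‖u z.1 z.2‖)
      (φ := fun z : ℝ × E => ‖p z.1 z.2‖) huK.norm hpK.norm
    exact memLp_one_iff_integrable.1 h
  have gG2 : IntegrableOn (fun z : ℝ × E => frobeniusNormSq (G z.1 z.2)) K volume := by
    refine ⟨(hfrob_c.comp_aestronglyMeasurable hGm'), ?_⟩
    have hfin := hG2 K hKΩ hKc
    refine lt_of_le_of_lt (lintegral_mono fun z => ?_) hfin
    rw [Real.enorm_eq_ofReal (frobeniusNormSq_nonneg _)]
  have gGi : ∀ i, IntegrableOn (fun z : ℝ × E => ‖G z.1 z.2 (b i)‖) K volume := by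
    intro i
    have hmeas : AEStronglyMeasurable (fun z : ℝ × E => G z.1 z.2 (b i)) (volume.restrict K) :=
      (ContinuousLinearMap.apply ℝ E (b i)).continuous.comp_aestronglyMeasurable hGm'
    have h2 : MemLp (fun z : ℝ × E => G z.1 z.2 (b i)) 2 (volume.restrict K) := by
      refine (memLp_two_iff_integrable_sq_norm hmeas).2 ?_
      refine Integrable.mono' gG2 (hmeas.norm.pow 2) (Eventually.of_forall fun z => ?_)
      rw [Real.norm_eq_abs, abs_of_nonneg (sq_nonneg _)]
      exact norm_apply_sq_le_frobeniusNormSq b _ i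
    exact (h2.integrable one_le_two).norm
  -- bounds of the weights on `K`
  obtain ⟨Cφ, hCφ0, hCφ⟩ := exists_forall_mem_norm_le_of_continuous hKc hφ_c
  obtain ⟨Cφt, hCφt0, hCφt⟩ := exists_forall_mem_norm_le_of_continuous hKc hφt_c
  obtain ⟨CLφ, hCLφ0, hCLφ⟩ := exists_forall_mem_norm_le_of_continuous hKc hLφ_c
  obtain ⟨Cgφ, hCgφ0, hCgφ⟩ := exists_forall_mem_norm_le_of_continuous hKc hgφ_c
  obtain ⟨Ce, hCe0, hCe⟩ := exists_forall_mem_norm_le_of_continuous hKc he_c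
  obtain ⟨CDe, hCDe0, hCDe⟩ := exists_forall_mem_norm_le_of_continuous hKc hDe_c
  obtain ⟨CLe, hCLe0, hCLe⟩ := exists_forall_mem_norm_le_of_continuous hKc hLe_c
  -- ### (2) the integrands and their integrability
  -- (LEI) left-hand side and the four pieces of the right-hand side
  have iL : Integrable (fun z : ℝ × E => frobeniusNormSq (G z.1 z.2) * φ z.1 z.2) volume := by
    refine integrable_of_bound_on_compact hKc (gG2.mul_const Cφ)
      ((hfrob_c.comp_aestronglyMeasurable hGm').mul hφ_c.aestronglyMeasurable)
      (fun z hz => by rw [hφK z hz, mul_zero]) fun z hz => ?_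
    rw [norm_mul, Real.norm_eq_abs, abs_of_nonneg (frobeniusNormSq_nonneg _)]
    exact mul_le_mul_of_nonneg_left (hCφ z hz) (frobeniusNormSq_nonneg _)
  have iA1 : Integrable (fun z : ℝ × E => ‖u z.1 z.2‖ ^ 2 * timeDeriv φ z.1 z.2) volume := by
    refine integrable_of_bound_on_compact hKc (gU2.mul_const Cφt)
      ((hum'.norm.pow 2).mul hφt_c.aestronglyMeasurable)
      (fun z hz => by rw [hφtK z hz, mul_zero]) fun z hz => ?_
    rw [norm_mul, Real.norm_eq_abs, abs_of_nonneg (sq_nonneg _)]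
    exact mul_le_mul_of_nonneg_left (hCφt z hz) (sq_nonneg _)
  have iA2 : Integrable (fun z : ℝ × E => ‖u z.1 z.2‖ ^ 2 * (Δ (φ z.1)) z.2) volume := by
    refine integrable_of_bound_on_compact hKc (gU2.mul_const CLφ)
      ((hum'.norm.pow 2).mul hLφ_c.aestronglyMeasurable)
      (fun z hz => by rw [hLφK z hz, mul_zero]) fun z hz => ?_
    rw [norm_mul, Real.norm_eq_abs, abs_of_nonneg (sq_nonneg _)]
    exact mul_le_mul_of_nonneg_left (hCLφ z hz) (sq_nonneg _)
  have iB1 : Integrable (fun z : ℝ × E => ‖u z.1 z.2‖ ^ 2 * ⟪u z.1 z.2, gradient (φ z.1) z.2⟫)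
      volume := by
    refine integrable_of_bound_on_compact hKc (gU3.mul_const Cgφ)
      ((hum'.norm.pow 2).mul (hum'.inner hgφ_c.aestronglyMeasurable))
      (fun z hz => by rw [hgφK z hz, inner_zero_right, mul_zero]) fun z hz => ?_
    rw [norm_mul, Real.norm_eq_abs, abs_of_nonneg (sq_nonneg _)]
    calc ‖u z.1 z.2‖ ^ 2 * ‖⟪u z.1 z.2, gradient (φ z.1) z.2⟫‖
        ≤ ‖u z.1 z.2‖ ^ 2 * (‖u z.1 z.2‖ * Cgφ) := by
          refine mul_le_mul_of_nonneg_left ?_ (sq_nonneg _)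
          exact (norm_inner_le_norm _ _).trans (mul_le_mul_of_nonneg_left (hCgφ z hz) (norm_nonneg _))
      _ = ‖u z.1 z.2‖ ^ 3 * Cgφ := by ring
  have iB2 : Integrable (fun z : ℝ × E => p z.1 z.2 * ⟪u z.1 z.2, gradient (φ z.1) z.2⟫) volume := by
    refine integrable_of_bound_on_compact hKc (gPU.mul_const Cgφ)
      (hpm'.mul (hum'.inner hgφ_c.aestronglyMeasurable))
      (fun z hz => by rw [hgφK z hz, inner_zero_right, mul_zero]) fun z hz => ?_
    rw [norm_mul]
    calc ‖p z.1 z.2‖ * ‖⟪u z.1 z.2, gradient (φ z.1) z.2⟫‖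
        ≤ ‖p z.1 z.2‖ * (‖u z.1 z.2‖ * Cgφ) := by
          refine mul_le_mul_of_nonneg_left ?_ (norm_nonneg _)
          exact (norm_inner_le_norm _ _).trans (mul_le_mul_of_nonneg_left (hCgφ z hz) (norm_nonneg _))
      _ = ‖p z.1 z.2‖ * ‖u z.1 z.2‖ * Cgφ := by ring
  -- (WG) the test functions `φ cᵢⱼ`, `cᵢⱼ = ⟪De(·) bᵢ, bⱼ⟫`
  set c : Fin (Module.finrank ℝ E) → Fin (Module.finrank ℝ E) → ℝ → E → ℝ :=
    fun i j t x => ⟪fderiv ℝ (e t) x (b i), b j⟫ with hc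
  have hci : ∀ i, IsSmoothSpaceTimeOn univ fun t x => fderiv ℝ (e t) x (b i) := fun i =>
    hDes.clm_apply (v := fun _ _ => b i) contDiffOn_const
  have hc_smooth : ∀ i j, ContDiff ℝ ((⊤ : ℕ∞) : WithTop ℕ∞) (uncurry (c i j)) := by
    intro i j
    have h1 : IsSmoothSpaceTimeOn univ (c i j) :=
      (hci i).inner (isSmoothSpaceTimeOn_const_time contDiff_const univ)
    rw [IsSmoothSpaceTimeOn, univ_prod_univ, contDiffOn_univ] at h1
    exact h1
  have hθ : ∀ i j, IsSpaceTimeTestOn Ω fun t x => φ t x * c i j t x := fun i j =>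
    hφ.mul_smooth (hc_smooth i j)
  have hcd : ∀ i j t x, DifferentiableAt ℝ (c i j t) x := fun i j t x =>
    ((contDiff_slice_of_uncurry (hc_smooth i j) t).differentiable (by simp)) x
  -- second derivatives of `e` along `bᵢ`
  have hdc : ∀ i j t x, fderiv ℝ (c i j t) x (b i) =
      ⟪fderiv ℝ (fun y => fderiv ℝ (e t) y (b i)) x (b i), b j⟫ := by
    intro i j t x
    have hd : DifferentiableAt ℝ (fun y => fderiv ℝ (e t) y (b i)) x :=
      (((he2 t).fderiv_right (m := 1) le_rfl).clm_apply contDiff_const).differentiable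
        one_ne_zero x
    change fderiv ℝ (fun y => ⟪fderiv ℝ (e t) y (b i), b j⟫) x (b i) = _
    rw [fderiv_inner_apply ℝ hd (differentiableAt_const _)]
    simp
  -- the derivative of the test function `φ cᵢⱼ` along `bᵢ`
  have hdθ : ∀ i j t x, fderiv ℝ (fun y => φ t y * c i j t y) x (b i) =
      fderiv ℝ (φ t) x (b i) * c i j t x +
        φ t x * ⟪fderiv ℝ (fun y => fderiv ℝ (e t) y (b i)) x (b i), b j⟫ := by
    intro i j t x
    rw [fderiv_fun_mul (hφd t x) (hcd i j t x)]
    simp only [_root_.add_apply, _root_.FunLike.coe_smul, Pi.smul_apply, smul_eq_mul, hdc]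
    ring
  -- ### (3) the remaining integrands
  -- (WG) right-hand sides `(φ cᵢⱼ) ⟪G bᵢ, bⱼ⟫` and left-hand sides `∂ᵢ(φ cᵢⱼ) ⟪u, bⱼ⟫`
  have iXij : ∀ i j, Integrable (fun z : ℝ × E =>
      (φ z.1 z.2 * c i j z.1 z.2) * ⟪G z.1 z.2 (b i), b j⟫) volume := by
    intro i j
    have hw_c : Continuous fun z : ℝ × E => φ z.1 z.2 * c i j z.1 z.2 :=
      (hθ i j).contDiff.continuous
    obtain ⟨Cw, hCw0, hCw⟩ := exists_forall_mem_norm_le_of_continuous hKc hw_c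
    refine integrable_of_bound_on_compact hKc ((gGi i).const_mul Cw)
      (hw_c.aestronglyMeasurable.mul
        (((ContinuousLinearMap.apply ℝ E (b i)).continuous.comp_aestronglyMeasurable hGm').inner
          aestronglyMeasurable_const))
      (fun z hz => by rw [hφK z hz, zero_mul, zero_mul]) fun z hz => ?_
    rw [norm_mul]
    have h2 : ‖⟪G z.1 z.2 (b i), b j⟫‖ ≤ ‖G z.1 z.2 (b i)‖ := by
      refine (norm_inner_le_norm _ _).trans ?_
      rw [b.orthonormal.1 j, mul_one]
    exact mul_le_mul (hCw z hz) h2 (norm_nonneg _) hCw0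
  have iYij : ∀ i j, Integrable (fun z : ℝ × E =>
      fderiv ℝ (fun y => φ z.1 y * c i j z.1 y) z.2 (b i) * ⟪u z.1 z.2, b j⟫) volume := by
    intro i j
    have hcont : Continuous fun z : ℝ × E => fderiv ℝ (fun y => φ z.1 y * c i j z.1 y) z.2 (b i) :=
      (((hθ i j).mono le_top).fderiv_apply_top (b i)).contDiff.continuous
    have hzero : ∀ z : ℝ × E, z ∉ K → fderiv ℝ (fun y => φ z.1 y * c i j z.1 y) z.2 (b i) = 0 := by
      intro z hz
      have hz' : z ∉ tsupport (uncurry fun t x => φ t x * c i j t x) := fun h =>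
        hz (tsupport_mul_subset_left (f := uncurry φ) (g := uncurry (c i j)) h)
      have h0 := IsSpaceTimeTestOn.fderiv_slice_eq_zero_of_notMem
        (ψ := fun t x => φ t x * c i j t x) hz'
      change fderiv ℝ (fun y => φ z.1 y * c i j z.1 y) z.2 (b i) = 0
      rw [h0, _root_.zero_apply]
    obtain ⟨Cw, hCw0, hCw⟩ := exists_forall_mem_norm_le_of_continuous hKc hcont
    refine integrable_of_bound_on_compact hKc (gU1.const_mul Cw)
      (hcont.aestronglyMeasurable.mul (hum'.inner aestronglyMeasurable_const))
      (fun z hz => by rw [hzero z hz, zero_mul]) fun z hz => ?_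
    rw [norm_mul]
    have h2 : ‖⟪u z.1 z.2, b j⟫‖ ≤ ‖u z.1 z.2‖ := by
      refine (norm_inner_le_norm _ _).trans ?_
      rw [b.orthonormal.1 j, mul_one]
    exact mul_le_mul (hCw z hz) h2 (norm_nonneg _) hCw0
  -- (WG)/(NS) the pairings `φ ⟪u, Δe⟫`, `⟪u, De(∇φ)⟫`
  have iM1 : Integrable (fun z : ℝ × E => φ z.1 z.2 * ⟪u z.1 z.2, (Δ (e z.1)) z.2⟫) volume := by
    refine integrable_of_bound_on_compact hKc (gU1.const_mul (Cφ * CLe))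
      (hφ_c.aestronglyMeasurable.mul (hum'.inner hLe_c.aestronglyMeasurable))
      (fun z hz => by rw [hφK z hz, zero_mul]) fun z hz => ?_
    rw [norm_mul]
    calc ‖φ z.1 z.2‖ * ‖⟪u z.1 z.2, (Δ (e z.1)) z.2⟫‖
        ≤ Cφ * (‖u z.1 z.2‖ * CLe) :=
          mul_le_mul (hCφ z hz) ((norm_inner_le_norm _ _).trans
            (mul_le_mul_of_nonneg_left (hCLe z hz) (norm_nonneg _))) (norm_nonneg _) hCφ0
      _ = Cφ * CLe * ‖u z.1 z.2‖ := by ring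
  have iM2 : Integrable (fun z : ℝ × E =>
      ⟪u z.1 z.2, fderiv ℝ (e z.1) z.2 (gradient (φ z.1) z.2)⟫) volume := by
    refine integrable_of_bound_on_compact hKc (gU1.const_mul (CDe * Cgφ))
      (hum'.inner (hDe_c.clm_apply hgφ_c).aestronglyMeasurable)
      (fun z hz => by rw [hgφK z hz, map_zero, inner_zero_right]) fun z hz => ?_
    calc ‖⟪u z.1 z.2, fderiv ℝ (e z.1) z.2 (gradient (φ z.1) z.2)⟫‖
        ≤ ‖u z.1 z.2‖ * (CDe * Cgφ) := (norm_inner_le_norm _ _).trans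
            (mul_le_mul_of_nonneg_left ((ContinuousLinearMap.le_opNorm _ _).trans
              (mul_le_mul (hCDe z hz) (hCgφ z hz) (norm_nonneg _) hCDe0)) (norm_nonneg _))
      _ = CDe * Cgφ * ‖u z.1 z.2‖ := by ring
  -- (NS) the pairings `φₜ ⟪u, e⟫`, `⟪u, ∇φ⟫⟪u, e⟫`, `φ ⟪De(u), u⟫`, `Δφ ⟪u, e⟫`, `p ⟪e, ∇φ⟫`
  have iP1 : Integrable (fun z : ℝ × E => timeDeriv φ z.1 z.2 * ⟪u z.1 z.2, e z.1 z.2⟫) volume := by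
    refine integrable_of_bound_on_compact hKc (gU1.const_mul (Cφt * Ce))
      (hφt_c.aestronglyMeasurable.mul (hum'.inner he_c.aestronglyMeasurable))
      (fun z hz => by rw [hφtK z hz, zero_mul]) fun z hz => ?_
    rw [norm_mul]
    calc ‖timeDeriv φ z.1 z.2‖ * ‖⟪u z.1 z.2, e z.1 z.2⟫‖ ≤ Cφt * (‖u z.1 z.2‖ * Ce) :=
          mul_le_mul (hCφt z hz) ((norm_inner_le_norm _ _).trans
            (mul_le_mul_of_nonneg_left (hCe z hz) (norm_nonneg _))) (norm_nonneg _) hCφt0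
      _ = Cφt * Ce * ‖u z.1 z.2‖ := by ring
  have iP2 : Integrable (fun z : ℝ × E =>
      ⟪u z.1 z.2, gradient (φ z.1) z.2⟫ * ⟪u z.1 z.2, e z.1 z.2⟫) volume := by
    refine integrable_of_bound_on_compact hKc (gU2.const_mul (Cgφ * Ce))
      ((hum'.inner hgφ_c.aestronglyMeasurable).mul (hum'.inner he_c.aestronglyMeasurable))
      (fun z hz => by rw [hgφK z hz, inner_zero_right, zero_mul]) fun z hz => ?_
    rw [norm_mul]
    calc ‖⟪u z.1 z.2, gradient (φ z.1) z.2⟫‖ * ‖⟪u z.1 z.2, e z.1 z.2⟫‖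
        ≤ (‖u z.1 z.2‖ * Cgφ) * (‖u z.1 z.2‖ * Ce) :=
          mul_le_mul ((norm_inner_le_norm _ _).trans (mul_le_mul_of_nonneg_left (hCgφ z hz)
            (norm_nonneg _))) ((norm_inner_le_norm _ _).trans (mul_le_mul_of_nonneg_left (hCe z hz)
            (norm_nonneg _))) (norm_nonneg _) (by positivity)
      _ = Cgφ * Ce * ‖u z.1 z.2‖ ^ 2 := by ring
  have hDeu : AEStronglyMeasurable (fun z : ℝ × E => fderiv ℝ (e z.1) z.2 (u z.1 z.2))
      (volume.restrict K) :=
    (isBoundedBilinearMap_apply (𝕜 := ℝ) (E := E) (F := E)).continuous.comp_aestronglyMeasurable₂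
      hDe_c.aestronglyMeasurable hum'
  have iP3 : Integrable (fun z : ℝ × E =>
      φ z.1 z.2 * ⟪fderiv ℝ (e z.1) z.2 (u z.1 z.2), u z.1 z.2⟫) volume := by
    refine integrable_of_bound_on_compact hKc (gU2.const_mul (Cφ * CDe))
      (hφ_c.aestronglyMeasurable.mul (hDeu.inner hum'))
      (fun z hz => by rw [hφK z hz, zero_mul]) fun z hz => ?_
    rw [norm_mul]
    calc ‖φ z.1 z.2‖ * ‖⟪fderiv ℝ (e z.1) z.2 (u z.1 z.2), u z.1 z.2⟫‖
        ≤ Cφ * ((CDe * ‖u z.1 z.2‖) * ‖u z.1 z.2‖) :=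
          mul_le_mul (hCφ z hz) ((norm_inner_le_norm _ _).trans (mul_le_mul_of_nonneg_right
            ((ContinuousLinearMap.le_opNorm _ _).trans (mul_le_mul_of_nonneg_right (hCDe z hz)
            (norm_nonneg _))) (norm_nonneg _))) (norm_nonneg _) hCφ0
      _ = Cφ * CDe * ‖u z.1 z.2‖ ^ 2 := by ring
  have iP4 : Integrable (fun z : ℝ × E => (Δ (φ z.1)) z.2 * ⟪u z.1 z.2, e z.1 z.2⟫) volume := by
    refine integrable_of_bound_on_compact hKc (gU1.const_mul (CLφ * Ce))
      (hLφ_c.aestronglyMeasurable.mul (hum'.inner he_c.aestronglyMeasurable))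
      (fun z hz => by rw [hLφK z hz, zero_mul]) fun z hz => ?_
    rw [norm_mul]
    calc ‖(Δ (φ z.1)) z.2‖ * ‖⟪u z.1 z.2, e z.1 z.2⟫‖ ≤ CLφ * (‖u z.1 z.2‖ * Ce) :=
          mul_le_mul (hCLφ z hz) ((norm_inner_le_norm _ _).trans
            (mul_le_mul_of_nonneg_left (hCe z hz) (norm_nonneg _))) (norm_nonneg _) hCLφ0
      _ = CLφ * Ce * ‖u z.1 z.2‖ := by ring
  have iP5 : Integrable (fun z : ℝ × E => p z.1 z.2 * ⟪e z.1 z.2, gradient (φ z.1) z.2⟫) volume := by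
    refine integrable_of_bound_on_compact hKc (gP1.mul_const (Ce * Cgφ))
      (hpm'.mul (he_c.inner hgφ_c).aestronglyMeasurable)
      (fun z hz => by rw [hgφK z hz, inner_zero_right, mul_zero]) fun z hz => ?_
    rw [norm_mul]
    exact mul_le_mul_of_nonneg_left ((norm_inner_le_norm _ _).trans
      (mul_le_mul (hCe z hz) (hCgφ z hz) (norm_nonneg _) hCe0)) (norm_nonneg _)
  -- (HEAT)/(expansions) the smooth integrands `|e|² φₜ`, `|e|² Δφ`, `φ |De|²`, `φ ⟪G, De⟫_F`
  have hint : ∀ {f : ℝ × E → ℝ}, Continuous f → (∀ z ∉ K, f z = 0) → Integrable f volume :=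
    fun hf h0 => hf.integrable_of_hasCompactSupport (HasCompactSupport.intro hKc h0)
  have iH1 : Integrable (fun z : ℝ × E => ‖e z.1 z.2‖ ^ 2 * timeDeriv φ z.1 z.2) volume :=
    hint ((he_c.norm.pow 2).mul hφt_c) fun z hz => by rw [hφtK z hz, mul_zero]
  have iH2 : Integrable (fun z : ℝ × E => ‖e z.1 z.2‖ ^ 2 * (Δ (φ z.1)) z.2) volume :=
    hint ((he_c.norm.pow 2).mul hLφ_c) fun z hz => by rw [hLφK z hz, mul_zero]
  have iN : Integrable (fun z : ℝ × E => φ z.1 z.2 * frobeniusNormSq (fderiv ℝ (e z.1) z.2)) volume :=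
    hint (hφ_c.mul (hfrob_c.comp hDe_c)) fun z hz => by rw [hφK z hz, zero_mul]
  have iFI : Integrable (fun z : ℝ × E =>
      φ z.1 z.2 * ∑ i, ⟪G z.1 z.2 (b i), fderiv ℝ (e z.1) z.2 (b i)⟫) volume := by
    have h1 : ∀ i, Integrable (fun z : ℝ × E =>
        φ z.1 z.2 * ⟪G z.1 z.2 (b i), fderiv ℝ (e z.1) z.2 (b i)⟫) volume := by
      intro i
      refine integrable_of_bound_on_compact hKc ((gGi i).const_mul (Cφ * CDe))
        (hφ_c.aestronglyMeasurable.mul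
          (((ContinuousLinearMap.apply ℝ E (b i)).continuous.comp_aestronglyMeasurable hGm').inner
            (hDe_c.clm_apply continuous_const).aestronglyMeasurable))
        (fun z hz => by rw [hφK z hz, zero_mul]) fun z hz => ?_
      rw [norm_mul]
      have h3 : ‖fderiv ℝ (e z.1) z.2 (b i)‖ ≤ CDe :=
        (ContinuousLinearMap.le_opNorm _ _).trans (by rw [b.orthonormal.1 i, mul_one]; exact hCDe z hz)
      calc ‖φ z.1 z.2‖ * ‖⟪G z.1 z.2 (b i), fderiv ℝ (e z.1) z.2 (b i)⟫‖
          ≤ Cφ * (‖G z.1 z.2 (b i)‖ * CDe) :=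
            mul_le_mul (hCφ z hz) ((norm_inner_le_norm _ _).trans
              (mul_le_mul_of_nonneg_left h3 (norm_nonneg _))) (norm_nonneg _) hCφ0
        _ = Cφ * CDe * ‖G z.1 z.2 (b i)‖ := by ring
    have h2 : Integrable (fun z : ℝ × E => ∑ i, φ z.1 z.2 * ⟪G z.1 z.2 (b i), fderiv ℝ (e z.1) z.2 (b i)⟫)
        volume := integrable_finsetSum Finset.univ fun i _ => h1 i
    refine h2.congr (Eventually.of_forall fun z => ?_)
    simp only [Finset.mul_sum]
  -- ### (4) the four inputs as identities between real numbers
  -- names for the integrals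
  set L : ℝ := ∫ z : ℝ × E, frobeniusNormSq (G z.1 z.2) * φ z.1 z.2 with hL
  set A1 : ℝ := ∫ z : ℝ × E, ‖u z.1 z.2‖ ^ 2 * timeDeriv φ z.1 z.2 with hA1
  set A2 : ℝ := ∫ z : ℝ × E, ‖u z.1 z.2‖ ^ 2 * (Δ (φ z.1)) z.2 with hA2
  set B1 : ℝ := ∫ z : ℝ × E, ‖u z.1 z.2‖ ^ 2 * ⟪u z.1 z.2, gradient (φ z.1) z.2⟫ with hB1
  set B2 : ℝ := ∫ z : ℝ × E, p z.1 z.2 * ⟪u z.1 z.2, gradient (φ z.1) z.2⟫ with hB2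
  set X1 : ℝ := ∫ z : ℝ × E, φ z.1 z.2 * ∑ i, ⟪G z.1 z.2 (b i), fderiv ℝ (e z.1) z.2 (b i)⟫ with hX1
  set M1 : ℝ := ∫ z : ℝ × E, φ z.1 z.2 * ⟪u z.1 z.2, (Δ (e z.1)) z.2⟫ with hM1
  set M2 : ℝ := ∫ z : ℝ × E, ⟪u z.1 z.2, fderiv ℝ (e z.1) z.2 (gradient (φ z.1) z.2)⟫ with hM2
  set P1 : ℝ := ∫ z : ℝ × E, timeDeriv φ z.1 z.2 * ⟪u z.1 z.2, e z.1 z.2⟫ with hP1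
  set P2 : ℝ := ∫ z : ℝ × E, ⟪u z.1 z.2, gradient (φ z.1) z.2⟫ * ⟪u z.1 z.2, e z.1 z.2⟫ with hP2
  set P3 : ℝ := ∫ z : ℝ × E, φ z.1 z.2 * ⟪fderiv ℝ (e z.1) z.2 (u z.1 z.2), u z.1 z.2⟫ with hP3
  set P4 : ℝ := ∫ z : ℝ × E, (Δ (φ z.1)) z.2 * ⟪u z.1 z.2, e z.1 z.2⟫ with hP4
  set P5 : ℝ := ∫ z : ℝ × E, p z.1 z.2 * ⟪e z.1 z.2, gradient (φ z.1) z.2⟫ with hP5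
  set H1 : ℝ := ∫ z : ℝ × E, ‖e z.1 z.2‖ ^ 2 * timeDeriv φ z.1 z.2 with hH1
  set H2 : ℝ := ∫ z : ℝ × E, ‖e z.1 z.2‖ ^ 2 * (Δ (φ z.1)) z.2 with hH2
  set N : ℝ := ∫ z : ℝ × E, φ z.1 z.2 * frobeniusNormSq (fderiv ℝ (e z.1) z.2) with hN
  -- (LEI)
  have hLEI' : 2 * ν * L ≤ A1 + ν * A2 + B1 + 2 * B2 := by
    have hle := hLEI φ hφ hφ0
    have iA2' : Integrable (fun z : ℝ × E => ν * (‖u z.1 z.2‖ ^ 2 * (Δ (φ z.1)) z.2)) volume :=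
      iA2.const_mul ν
    have iB2' : Integrable (fun z : ℝ × E => 2 * (p z.1 z.2 * ⟪u z.1 z.2, gradient (φ z.1) z.2⟫))
        volume := iB2.const_mul 2
    have iB12 : Integrable (fun z : ℝ × E => ‖u z.1 z.2‖ ^ 2 * ⟪u z.1 z.2, gradient (φ z.1) z.2⟫ +
        2 * (p z.1 z.2 * ⟪u z.1 z.2, gradient (φ z.1) z.2⟫)) volume := iB1.add iB2'
    have iAB : Integrable (fun z : ℝ × E => ν * (‖u z.1 z.2‖ ^ 2 * (Δ (φ z.1)) z.2) +
        (‖u z.1 z.2‖ ^ 2 * ⟪u z.1 z.2, gradient (φ z.1) z.2⟫ +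
          2 * (p z.1 z.2 * ⟪u z.1 z.2, gradient (φ z.1) z.2⟫))) volume := iA2'.add iB12
    have iR : Integrable (fun z : ℝ × E => ‖u z.1 z.2‖ ^ 2 * (timeDeriv φ z.1 z.2 + ν * Δ (φ z.1) z.2) +
        (‖u z.1 z.2‖ ^ 2 + 2 * p z.1 z.2) * ⟪u z.1 z.2, gradient (φ z.1) z.2⟫ +
        2 * ⟪(0 : ℝ → E → E) z.1 z.2, u z.1 z.2⟫ * φ z.1 z.2) volume := by
      refine (iA1.add iAB).congr (Eventually.of_forall fun z => ?_)
      simp only [Pi.add_apply, Pi.zero_apply, inner_zero_left, mul_zero, zero_mul, add_zero]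
      ring
    have h1 : ∫ t, ∫ x, frobeniusNormSq (G t x) * φ t x = L :=
      (integral_prod (μ := volume) (ν := volume) _ iL).symm
    have h2 : ∫ t, ∫ x, (‖u t x‖ ^ 2 * (timeDeriv φ t x + ν * Δ (φ t) x) +
        (‖u t x‖ ^ 2 + 2 * p t x) * ⟪u t x, gradient (φ t) x⟫ +
        2 * ⟪(0 : ℝ → E → E) t x, u t x⟫ * φ t x) = A1 + ν * A2 + B1 + 2 * B2 := by
      rw [← integral_prod (μ := volume) (ν := volume) _ iR]
      change ∫ z : ℝ × E, (‖u z.1 z.2‖ ^ 2 * (timeDeriv φ z.1 z.2 + ν * Δ (φ z.1) z.2) +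
        (‖u z.1 z.2‖ ^ 2 + 2 * p z.1 z.2) * ⟪u z.1 z.2, gradient (φ z.1) z.2⟫ +
        2 * ⟪(0 : ℝ → E → E) z.1 z.2, u z.1 z.2⟫ * φ z.1 z.2) = A1 + ν * A2 + B1 + 2 * B2
      have e1 : (fun z : ℝ × E => ‖u z.1 z.2‖ ^ 2 * (timeDeriv φ z.1 z.2 + ν * Δ (φ z.1) z.2) +
          (‖u z.1 z.2‖ ^ 2 + 2 * p z.1 z.2) * ⟪u z.1 z.2, gradient (φ z.1) z.2⟫ +
          2 * ⟪(0 : ℝ → E → E) z.1 z.2, u z.1 z.2⟫ * φ z.1 z.2) =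
          fun z : ℝ × E => ‖u z.1 z.2‖ ^ 2 * timeDeriv φ z.1 z.2 +
            (ν * (‖u z.1 z.2‖ ^ 2 * (Δ (φ z.1)) z.2) +
              (‖u z.1 z.2‖ ^ 2 * ⟪u z.1 z.2, gradient (φ z.1) z.2⟫ +
                2 * (p z.1 z.2 * ⟪u z.1 z.2, gradient (φ z.1) z.2⟫))) := by
        funext z
        simp only [Pi.zero_apply, inner_zero_left, mul_zero, zero_mul, add_zero]
        ring
      rw [e1, integral_add iA1 iAB, integral_add iA2' iB12, integral_add iB1 iB2', integral_const_mul,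
        integral_const_mul, hA1, hA2, hB1, hB2]
      ring
    rw [h1, h2] at hle
    exact hle
  -- (HEAT)
  have hHeat : H1 + ν * H2 = 2 * ν * N := caloric_local_energy_identity he hheat hφ
  -- (WG)
  have hWG : X1 = -(M1 + M2) := by
    -- entry-wise identities, in product form
    have hij : ∀ i j, ∫ z : ℝ × E, fderiv ℝ (fun y => φ z.1 y * c i j z.1 y) z.2 (b i) *
        ⟪u z.1 z.2, b j⟫ = -∫ z : ℝ × E, (φ z.1 z.2 * c i j z.1 z.2) * ⟪G z.1 z.2 (b i), b j⟫ := by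
      intro i j
      have h := hG.integral_fderiv_mul_inner_eq (fun t x => φ t x * c i j t x) (hθ i j) (b i) (b j)
      have h1 := integral_prod (μ := volume) (ν := volume) _ (iYij i j)
      have h2 := integral_prod (μ := volume) (ν := volume) _ (iXij i j)
      rw [← Measure.volume_eq_prod] at h1 h2
      rw [h1, h2]
      exact h
    -- sum over `i`, `j`
    have hsumY : ∫ z : ℝ × E, ∑ i, ∑ j, fderiv ℝ (fun y => φ z.1 y * c i j z.1 y) z.2 (b i) *
        ⟪u z.1 z.2, b j⟫ = -∫ z : ℝ × E, ∑ i, ∑ j, (φ z.1 z.2 * c i j z.1 z.2) * ⟪G z.1 z.2 (b i), b j⟫ := by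
      have iYi : ∀ i, Integrable (fun z : ℝ × E => ∑ j, fderiv ℝ (fun y => φ z.1 y * c i j z.1 y) z.2 (b i) *
          ⟪u z.1 z.2, b j⟫) volume := fun i => integrable_finsetSum _ fun j _ => iYij i j
      have iXi : ∀ i, Integrable (fun z : ℝ × E => ∑ j, (φ z.1 z.2 * c i j z.1 z.2) *
          ⟪G z.1 z.2 (b i), b j⟫) volume := fun i => integrable_finsetSum _ fun j _ => iXij i j
      rw [integral_finsetSum _ fun i _ => iYi i, integral_finsetSum _ fun i _ => iXi i,
        ← Finset.sum_neg_distrib]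
      refine Finset.sum_congr rfl fun i _ => ?_
      rw [integral_finsetSum _ fun j _ => iYij i j, integral_finsetSum _ fun j _ => iXij i j,
        ← Finset.sum_neg_distrib]
      exact Finset.sum_congr rfl fun j _ => hij i j
    -- pointwise evaluation of the sums
    have hYsum : ∀ z : ℝ × E, ∑ i, ∑ j, fderiv ℝ (fun y => φ z.1 y * c i j z.1 y) z.2 (b i) *
        ⟪u z.1 z.2, b j⟫ = ⟪u z.1 z.2, fderiv ℝ (e z.1) z.2 (gradient (φ z.1) z.2)⟫ +
          φ z.1 z.2 * ⟪u z.1 z.2, (Δ (e z.1)) z.2⟫ := by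
      intro z
      have hA : ∀ i, ∑ j, c i j z.1 z.2 * ⟪u z.1 z.2, b j⟫ = ⟪fderiv ℝ (e z.1) z.2 (b i), u z.1 z.2⟫ := by
        intro i
        rw [← b.sum_inner_mul_inner (fderiv ℝ (e z.1) z.2 (b i)) (u z.1 z.2)]
        refine Finset.sum_congr rfl fun j _ => ?_
        simp only [hc, real_inner_comm (b j) (u z.1 z.2)]
      have hB : ∀ i, ∑ j, ⟪fderiv ℝ (fun y => fderiv ℝ (e z.1) y (b i)) z.2 (b i), b j⟫ *
          ⟪u z.1 z.2, b j⟫ = ⟪fderiv ℝ (fun y => fderiv ℝ (e z.1) y (b i)) z.2 (b i), u z.1 z.2⟫ := by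
        intro i
        rw [← b.sum_inner_mul_inner (fderiv ℝ (fun y => fderiv ℝ (e z.1) y (b i)) z.2 (b i)) (u z.1 z.2)]
        refine Finset.sum_congr rfl fun j _ => ?_
        rw [real_inner_comm (b j) (u z.1 z.2)]
      have h1 : ∀ i, ∑ j, fderiv ℝ (fun y => φ z.1 y * c i j z.1 y) z.2 (b i) * ⟪u z.1 z.2, b j⟫ =
          fderiv ℝ (φ z.1) z.2 (b i) * ⟪fderiv ℝ (e z.1) z.2 (b i), u z.1 z.2⟫ +
            φ z.1 z.2 * ⟪fderiv ℝ (fun y => fderiv ℝ (e z.1) y (b i)) z.2 (b i), u z.1 z.2⟫ := by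
        intro i
        rw [← hA i, ← hB i, Finset.mul_sum, Finset.mul_sum, ← Finset.sum_add_distrib]
        refine Finset.sum_congr rfl fun j _ => ?_
        rw [hdθ i j z.1 z.2]
        ring
      rw [Finset.sum_congr rfl fun i _ => h1 i, Finset.sum_add_distrib, ← Finset.mul_sum]
      congr 1
      · rw [← sum_fderiv_smul_fderiv_eq b (φ z.1) (e z.1) z.2, real_inner_comm, sum_inner]
        exact Finset.sum_congr rfl fun i _ => by rw [real_inner_smul_left]
      · rw [laplacian_eq_sum_fderiv_fderiv b (he2 z.1) z.2, real_inner_comm, sum_inner]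
    have hXsum : ∀ z : ℝ × E, ∑ i, ∑ j, (φ z.1 z.2 * c i j z.1 z.2) * ⟪G z.1 z.2 (b i), b j⟫ =
        φ z.1 z.2 * ∑ i, ⟪G z.1 z.2 (b i), fderiv ℝ (e z.1) z.2 (b i)⟫ := by
      intro z
      rw [Finset.mul_sum]
      refine Finset.sum_congr rfl fun i _ => ?_
      have hC : ∑ j, c i j z.1 z.2 * ⟪G z.1 z.2 (b i), b j⟫ = ⟪G z.1 z.2 (b i), fderiv ℝ (e z.1) z.2 (b i)⟫ := by
        rw [real_inner_comm, ← b.sum_inner_mul_inner (fderiv ℝ (e z.1) z.2 (b i)) (G z.1 z.2 (b i))]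
        refine Finset.sum_congr rfl fun j _ => ?_
        simp only [hc, real_inner_comm (b j) (G z.1 z.2 (b i))]
      rw [← hC, Finset.mul_sum]
      refine Finset.sum_congr rfl fun j _ => ?_
      ring
    simp only [hYsum, hXsum] at hsumY
    rw [integral_add iM2 iM1] at hsumY
    rw [hX1, hM1, hM2]
    linarith
  -- (NS) tested with `ψ = φ e`
  have hNS' : P1 + 2 * ν * M1 + P2 + P3 + ν * P4 + 2 * ν * M2 + P5 = 0 := by
    set ψ : ℝ → E → E := fun t x => φ t x • e t x with hψ_def
    have hψ : IsSpaceTimeTestOn Ω ψ := hφ.smul_field he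
    have h0 := hNS.2.2.2.2 ψ hψ
    -- the integrand in expanded form
    set NSI' : ℝ × E → ℝ := fun z =>
      timeDeriv φ z.1 z.2 * ⟪u z.1 z.2, e z.1 z.2⟫ +
        (2 * ν * (φ z.1 z.2 * ⟪u z.1 z.2, (Δ (e z.1)) z.2⟫) +
        (⟪u z.1 z.2, gradient (φ z.1) z.2⟫ * ⟪u z.1 z.2, e z.1 z.2⟫ +
        (φ z.1 z.2 * ⟪fderiv ℝ (e z.1) z.2 (u z.1 z.2), u z.1 z.2⟫ +
        (ν * ((Δ (φ z.1)) z.2 * ⟪u z.1 z.2, e z.1 z.2⟫) +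
        (2 * ν * ⟪u z.1 z.2, fderiv ℝ (e z.1) z.2 (gradient (φ z.1) z.2)⟫ +
        p z.1 z.2 * ⟪e z.1 z.2, gradient (φ z.1) z.2⟫))))) with hNSI'
    have hpt : ∀ z ∈ (Ω : Set (ℝ × E)),
        ⟪u z.1 z.2, timeDeriv ψ z.1 z.2⟫ + ⟪u z.1 z.2, convect (u z.1) (ψ z.1) z.2⟫ +
          ν * ⟪u z.1 z.2, Δ (ψ z.1) z.2⟫ + p z.1 z.2 * VectorCalculus.divergence (ψ z.1) z.2 +
          ⟪(0 : ℝ → E → E) z.1 z.2, ψ z.1 z.2⟫ = NSI' z := by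
      intro z hz
      have ht : timeDeriv ψ z.1 z.2 = timeDeriv φ z.1 z.2 • e z.1 z.2 +
          φ z.1 z.2 • (ν • (Δ (e z.1)) z.2) := by
        rw [hψ_def, timeDeriv_smul_field hφ.contDiff he, (hheat z hz).deriv]
      have hcv : convect (u z.1) (ψ z.1) z.2 =
          ⟪u z.1 z.2, gradient (φ z.1) z.2⟫ • e z.1 z.2 + φ z.1 z.2 • convect (u z.1) (e z.1) z.2 :=
        convect_smul_field (hφd z.1 z.2) (hed z.1 z.2)
      have hlap : (Δ (ψ z.1)) z.2 = φ z.1 z.2 • (Δ (e z.1)) z.2 +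
          (2 : ℝ) • fderiv ℝ (e z.1) z.2 (gradient (φ z.1) z.2) + ((Δ (φ z.1)) z.2) • e z.1 z.2 :=
        laplacian_smul_field (hφ2 z.1) (he2 z.1) z.2
      have hdv : VectorCalculus.divergence (ψ z.1) z.2 = ⟪e z.1 z.2, gradient (φ z.1) z.2⟫ :=
        divergence_smul_field (hφd z.1 z.2) (hed z.1 z.2) (hdiv z.1 z.2)
      rw [ht, hcv, hlap, hdv, hNSI']
      simp only [inner_add_right, inner_smul_right, Pi.zero_apply, inner_zero_left, add_zero,
        convect, real_inner_comm (fderiv ℝ (e z.1) z.2 (u z.1 z.2)) (u z.1 z.2)]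
      ring
    have hzero : ∀ z : ℝ × E, z ∉ (Ω : Set (ℝ × E)) → NSI' z = 0 := by
      intro z hz
      have hzK : z ∉ K := fun h => hz (hKΩ h)
      simp only [hNSI', hφK z hzK, hφtK z hzK, hgφK z hzK, hLφK z hzK, map_zero, inner_zero_right,
        zero_mul, mul_zero, add_zero]
    have h1 : ∫ z : ℝ × E, NSI' z = 0 := by
      rw [← setIntegral_eq_integral_of_forall_compl_eq_zero (s := (Ω : Set (ℝ × E)))
        (fun z hz => hzero z hz), ← h0]
      exact (setIntegral_congr_fun Ω.isOpen.measurableSet fun z hz => (hpt z hz).symm)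
    -- split the integral
    have iM1' : Integrable (fun z : ℝ × E => 2 * ν * (φ z.1 z.2 * ⟪u z.1 z.2, (Δ (e z.1)) z.2⟫)) volume :=
      iM1.const_mul _
    have iP4' : Integrable (fun z : ℝ × E => ν * ((Δ (φ z.1)) z.2 * ⟪u z.1 z.2, e z.1 z.2⟫)) volume :=
      iP4.const_mul _
    have iM2' : Integrable (fun z : ℝ × E =>
        2 * ν * ⟪u z.1 z.2, fderiv ℝ (e z.1) z.2 (gradient (φ z.1) z.2)⟫) volume := iM2.const_mul _
    have i6 : Integrable (fun z : ℝ × E =>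
        2 * ν * ⟪u z.1 z.2, fderiv ℝ (e z.1) z.2 (gradient (φ z.1) z.2)⟫ +
        p z.1 z.2 * ⟪e z.1 z.2, gradient (φ z.1) z.2⟫) volume := iM2'.add iP5
    have i5 : Integrable (fun z : ℝ × E => ν * ((Δ (φ z.1)) z.2 * ⟪u z.1 z.2, e z.1 z.2⟫) +
        (2 * ν * ⟪u z.1 z.2, fderiv ℝ (e z.1) z.2 (gradient (φ z.1) z.2)⟫ +
        p z.1 z.2 * ⟪e z.1 z.2, gradient (φ z.1) z.2⟫)) volume := iP4'.add i6
    have i4 : Integrable (fun z : ℝ × E => φ z.1 z.2 * ⟪fderiv ℝ (e z.1) z.2 (u z.1 z.2), u z.1 z.2⟫ +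
        (ν * ((Δ (φ z.1)) z.2 * ⟪u z.1 z.2, e z.1 z.2⟫) +
        (2 * ν * ⟪u z.1 z.2, fderiv ℝ (e z.1) z.2 (gradient (φ z.1) z.2)⟫ +
        p z.1 z.2 * ⟪e z.1 z.2, gradient (φ z.1) z.2⟫))) volume := iP3.add i5
    have i3 : Integrable (fun z : ℝ × E => ⟪u z.1 z.2, gradient (φ z.1) z.2⟫ * ⟪u z.1 z.2, e z.1 z.2⟫ +
        (φ z.1 z.2 * ⟪fderiv ℝ (e z.1) z.2 (u z.1 z.2), u z.1 z.2⟫ +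
        (ν * ((Δ (φ z.1)) z.2 * ⟪u z.1 z.2, e z.1 z.2⟫) +
        (2 * ν * ⟪u z.1 z.2, fderiv ℝ (e z.1) z.2 (gradient (φ z.1) z.2)⟫ +
        p z.1 z.2 * ⟪e z.1 z.2, gradient (φ z.1) z.2⟫)))) volume := iP2.add i4
    have i2 : Integrable (fun z : ℝ × E => 2 * ν * (φ z.1 z.2 * ⟪u z.1 z.2, (Δ (e z.1)) z.2⟫) +
        (⟪u z.1 z.2, gradient (φ z.1) z.2⟫ * ⟪u z.1 z.2, e z.1 z.2⟫ +
        (φ z.1 z.2 * ⟪fderiv ℝ (e z.1) z.2 (u z.1 z.2), u z.1 z.2⟫ +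
        (ν * ((Δ (φ z.1)) z.2 * ⟪u z.1 z.2, e z.1 z.2⟫) +
        (2 * ν * ⟪u z.1 z.2, fderiv ℝ (e z.1) z.2 (gradient (φ z.1) z.2)⟫ +
        p z.1 z.2 * ⟪e z.1 z.2, gradient (φ z.1) z.2⟫))))) volume := iM1'.add i3
    have hsplit : ∫ z : ℝ × E, NSI' z = P1 + 2 * ν * M1 + P2 + P3 + ν * P4 + 2 * ν * M2 + P5 := by
      rw [hNSI', integral_add iP1 i2, integral_add iM1' i3, integral_add iP2 i4, integral_add iP3 i5,
        integral_add iP4' i6, integral_add iM2' iP5, integral_const_mul, integral_const_mul,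
        integral_const_mul, hP1, hM1, hP2, hP3, hP4, hM2, hP5]
      ring
    rw [hsplit] at h1
    exact h1
  -- ### (5) the expansions and the conclusion
  -- pointwise expansion of `|G - De|² φ`
  have hGw_pt : ∀ z : ℝ × E, frobeniusNormSq (G z.1 z.2 - fderiv ℝ (e z.1) z.2) * φ z.1 z.2 =
      frobeniusNormSq (G z.1 z.2) * φ z.1 z.2 -
        2 * (φ z.1 z.2 * ∑ i, ⟪G z.1 z.2 (b i), fderiv ℝ (e z.1) z.2 (b i)⟫) +
        φ z.1 z.2 * frobeniusNormSq (fderiv ℝ (e z.1) z.2) := by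
    intro z
    rw [frobeniusNormSq_eq_sum b, frobeniusNormSq_eq_sum b, frobeniusNormSq_eq_sum b, Finset.mul_sum,
      Finset.mul_sum, Finset.sum_mul, Finset.sum_mul, Finset.mul_sum, ← Finset.sum_sub_distrib,
      ← Finset.sum_add_distrib]
    refine Finset.sum_congr rfl fun i _ => ?_
    rw [_root_.sub_apply, norm_sub_sq_real]
    ring
  have iFI2 : Integrable (fun z : ℝ × E =>
      2 * (φ z.1 z.2 * ∑ i, ⟪G z.1 z.2 (b i), fderiv ℝ (e z.1) z.2 (b i)⟫)) volume := iFI.const_mul 2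
  have iLF : Integrable (fun z : ℝ × E => frobeniusNormSq (G z.1 z.2) * φ z.1 z.2 -
      2 * (φ z.1 z.2 * ∑ i, ⟪G z.1 z.2 (b i), fderiv ℝ (e z.1) z.2 (b i)⟫)) volume := iL.sub iFI2
  have iGw : Integrable (fun z : ℝ × E =>
      frobeniusNormSq (G z.1 z.2 - fderiv ℝ (e z.1) z.2) * φ z.1 z.2) volume :=
    (iLF.add iN).congr (Eventually.of_forall fun z => (hGw_pt z).symm)
  have hE1 : ∫ t, ∫ x, frobeniusNormSq (G t x - fderiv ℝ (e t) x) * φ t x = L - 2 * X1 + N := by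
    rw [← integral_prod (μ := volume) (ν := volume) _ iGw]
    change ∫ z : ℝ × E, frobeniusNormSq (G z.1 z.2 - fderiv ℝ (e z.1) z.2) * φ z.1 z.2 = L - 2 * X1 + N
    rw [funext hGw_pt, integral_add iLF iN, integral_sub iL iFI2, integral_const_mul, hL, hX1, hN]
  -- `W = ∫∫ |u - e|² (φₜ + νΔφ)`
  have hW_pt : ∀ z : ℝ × E, ‖u z.1 z.2 - e z.1 z.2‖ ^ 2 * (timeDeriv φ z.1 z.2 + ν * Δ (φ z.1) z.2) =
      (‖u z.1 z.2‖ ^ 2 * timeDeriv φ z.1 z.2 + ν * (‖u z.1 z.2‖ ^ 2 * (Δ (φ z.1)) z.2)) -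
        (2 * (timeDeriv φ z.1 z.2 * ⟪u z.1 z.2, e z.1 z.2⟫) +
          2 * ν * ((Δ (φ z.1)) z.2 * ⟪u z.1 z.2, e z.1 z.2⟫)) +
        (‖e z.1 z.2‖ ^ 2 * timeDeriv φ z.1 z.2 + ν * (‖e z.1 z.2‖ ^ 2 * (Δ (φ z.1)) z.2)) := by
    intro z
    rw [norm_sub_sq_real]
    ring
  have iA2' : Integrable (fun z : ℝ × E => ν * (‖u z.1 z.2‖ ^ 2 * (Δ (φ z.1)) z.2)) volume :=
    iA2.const_mul ν
  have iP1' : Integrable (fun z : ℝ × E => 2 * (timeDeriv φ z.1 z.2 * ⟪u z.1 z.2, e z.1 z.2⟫)) volume :=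
    iP1.const_mul 2
  have iP4'' : Integrable (fun z : ℝ × E => 2 * ν * ((Δ (φ z.1)) z.2 * ⟪u z.1 z.2, e z.1 z.2⟫)) volume :=
    iP4.const_mul _
  have iH2' : Integrable (fun z : ℝ × E => ν * (‖e z.1 z.2‖ ^ 2 * (Δ (φ z.1)) z.2)) volume :=
    iH2.const_mul ν
  have iAA : Integrable (fun z : ℝ × E => ‖u z.1 z.2‖ ^ 2 * timeDeriv φ z.1 z.2 +
      ν * (‖u z.1 z.2‖ ^ 2 * (Δ (φ z.1)) z.2)) volume := iA1.add iA2'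
  have iPP : Integrable (fun z : ℝ × E => 2 * (timeDeriv φ z.1 z.2 * ⟪u z.1 z.2, e z.1 z.2⟫) +
      2 * ν * ((Δ (φ z.1)) z.2 * ⟪u z.1 z.2, e z.1 z.2⟫)) volume := iP1'.add iP4''
  have iHH : Integrable (fun z : ℝ × E => ‖e z.1 z.2‖ ^ 2 * timeDeriv φ z.1 z.2 +
      ν * (‖e z.1 z.2‖ ^ 2 * (Δ (φ z.1)) z.2)) volume := iH1.add iH2'
  have iAP : Integrable (fun z : ℝ × E => (‖u z.1 z.2‖ ^ 2 * timeDeriv φ z.1 z.2 +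
      ν * (‖u z.1 z.2‖ ^ 2 * (Δ (φ z.1)) z.2)) -
      (2 * (timeDeriv φ z.1 z.2 * ⟪u z.1 z.2, e z.1 z.2⟫) +
        2 * ν * ((Δ (φ z.1)) z.2 * ⟪u z.1 z.2, e z.1 z.2⟫))) volume := iAA.sub iPP
  have iW : Integrable (fun z : ℝ × E =>
      ‖u z.1 z.2 - e z.1 z.2‖ ^ 2 * (timeDeriv φ z.1 z.2 + ν * Δ (φ z.1) z.2)) volume :=
    (iAP.add iHH).congr (Eventually.of_forall fun z => (hW_pt z).symm)
  have hE2 : ∫ t, ∫ x, ‖u t x - e t x‖ ^ 2 * (timeDeriv φ t x + ν * Δ (φ t) x) =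
      A1 + ν * A2 - (2 * P1 + 2 * ν * P4) + (H1 + ν * H2) := by
    rw [← integral_prod (μ := volume) (ν := volume) _ iW]
    change ∫ z : ℝ × E, ‖u z.1 z.2 - e z.1 z.2‖ ^ 2 * (timeDeriv φ z.1 z.2 + ν * Δ (φ z.1) z.2) = _
    rw [funext hW_pt, integral_add iAP iHH, integral_sub iAA iPP, integral_add iA1 iA2',
      integral_add iP1' iP4'', integral_add iH1 iH2', integral_const_mul, integral_const_mul,
      integral_const_mul, integral_const_mul, hA1, hA2, hP1, hP4, hH1, hH2]
  -- the transport term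
  have hT_pt : ∀ z : ℝ × E, (‖u z.1 z.2 - e z.1 z.2‖ ^ 2 - ‖e z.1 z.2‖ ^ 2) * ⟪u z.1 z.2, gradient (φ z.1) z.2⟫ =
      ‖u z.1 z.2‖ ^ 2 * ⟪u z.1 z.2, gradient (φ z.1) z.2⟫ -
        2 * (⟪u z.1 z.2, gradient (φ z.1) z.2⟫ * ⟪u z.1 z.2, e z.1 z.2⟫) := by
    intro z
    rw [norm_sub_sq_real]
    ring
  have iP2' : Integrable (fun z : ℝ × E =>
      2 * (⟪u z.1 z.2, gradient (φ z.1) z.2⟫ * ⟪u z.1 z.2, e z.1 z.2⟫)) volume := iP2.const_mul 2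
  have iT : Integrable (fun z : ℝ × E =>
      (‖u z.1 z.2 - e z.1 z.2‖ ^ 2 - ‖e z.1 z.2‖ ^ 2) * ⟪u z.1 z.2, gradient (φ z.1) z.2⟫) volume :=
    (iB1.sub iP2').congr (Eventually.of_forall fun z => (hT_pt z).symm)
  have hE3 : ∫ t, ∫ x, (‖u t x - e t x‖ ^ 2 - ‖e t x‖ ^ 2) * ⟪u t x, gradient (φ t) x⟫ =
      B1 - 2 * P2 := by
    rw [← integral_prod (μ := volume) (ν := volume) _ iT]
    change ∫ z : ℝ × E, (‖u z.1 z.2 - e z.1 z.2‖ ^ 2 - ‖e z.1 z.2‖ ^ 2) *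
      ⟪u z.1 z.2, gradient (φ z.1) z.2⟫ = _
    rw [funext hT_pt, integral_sub iB1 iP2', integral_const_mul, hB1, hP2]
  -- the pressure term
  have hPr_pt : ∀ z : ℝ × E, p z.1 z.2 * ⟪u z.1 z.2 - e z.1 z.2, gradient (φ z.1) z.2⟫ =
      p z.1 z.2 * ⟪u z.1 z.2, gradient (φ z.1) z.2⟫ - p z.1 z.2 * ⟪e z.1 z.2, gradient (φ z.1) z.2⟫ := by
    intro z
    rw [inner_sub_left]
    ring
  have iPr : Integrable (fun z : ℝ × E => p z.1 z.2 * ⟪u z.1 z.2 - e z.1 z.2, gradient (φ z.1) z.2⟫)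
      volume := (iB2.sub iP5).congr (Eventually.of_forall fun z => (hPr_pt z).symm)
  have hE4 : ∫ t, ∫ x, p t x * ⟪u t x - e t x, gradient (φ t) x⟫ = B2 - P5 := by
    rw [← integral_prod (μ := volume) (ν := volume) _ iPr]
    change ∫ z : ℝ × E, p z.1 z.2 * ⟪u z.1 z.2 - e z.1 z.2, gradient (φ z.1) z.2⟫ = _
    rw [funext hPr_pt, integral_sub iB2 iP5, hB2, hP5]
  have hE5 : ∫ t, ∫ x, φ t x * ⟪fderiv ℝ (e t) x (u t x), u t x⟫ = P3 :=
    (integral_prod (μ := volume) (ν := volume) _ iP3).symm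
  -- conclusion
  rw [hE1, hE2, hE3, hE4, hE5]
  have key : A1 + ν * A2 + B1 + 2 * B2 + 4 * ν * M1 + 4 * ν * M2 + 2 * ν * N =
      A1 + ν * A2 - (2 * P1 + 2 * ν * P4) + (H1 + ν * H2) + (B1 - 2 * P2) + 2 * (B2 - P5) - 2 * P3 := by
    linear_combination 2 * hNS' - hHeat
  calc 2 * ν * (L - 2 * X1 + N) = 2 * ν * L + 4 * ν * M1 + 4 * ν * M2 + 2 * ν * N := by
        linear_combination (-4 * ν) * hWG
    _ ≤ A1 + ν * A2 + B1 + 2 * B2 + 4 * ν * M1 + 4 * ν * M2 + 2 * ν * N := by linarith [hLEI']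
    _ = _ := key

set_option maxHeartbeats 1600000 in
/-- **Energy inequality of the caloric remainder, with the coupling term expanded**
(Rusin–Šverák 2011, §4 p. 6; Lemarié-Rieusset 2016, proof of Thm. 14.7, p. 516: the terms
`A = w·((w·∇)u₁)` and the transport of `|w|²`, `|u₁|²` by `u`, `u₁`). In the setting of
`caloric_remainder_local_energy_inequality` with `ν > 0`, write `w = u - e`, `∇w = G - De`. The
coupling `-2 ∫∫ φ ⟪De(u), u⟫` is expanded by `u = w + e`:
`⟪De(u), u⟫ = ⟪De(w), w⟫ + ⟪De(w), e⟫ + ⟪De(e), w⟫ + ⟪De(e), e⟫`, where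
(i) `|⟪De(w), w⟫| ≤ ‖De‖ |w|²`; (ii) `∫∫ φ⟪De(w), e⟫ = -½ ∫∫ |e|² w·∇φ` and
`∫∫ φ⟪De(e), e⟫ = -½ ∫∫ |e|² e·∇φ` (weak divergence-freeness of `u`, hence of `w`, and of `e`,
tested with `θ = ½|e|²φ`); (iii) `∫∫ φ⟪De(e), w⟫ = -∫∫ φ⟪∇w(e), e⟫ - ∫∫ (e·∇φ)(e·w)` (the
weak-gradient identity for `w` tested with `φ eᵢeⱼ`, using `div e = 0`), and
`2|⟪∇w(e), e⟫| ≤ ν|∇w|² + ν⁻¹|e|⁴` is absorbed. Result (iterated integrals):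
`ν ∫∫ |∇w|²φ ≤ ∫∫ |w|²(φₜ + νΔφ) + ∫∫ (|w|² - |e|²) u·∇φ + 2∫∫ p w·∇φ + 2∫∫ φ ‖De‖ |w|²
 + ν⁻¹ ∫∫ φ|e|⁴ + ∫∫ |e|² w·∇φ + 2∫∫ (e·∇φ)(e·w) + ∫∫ (e·∇φ)|e|²`.
[cite: LemarieRieusset2016, Thm. 14.7, proof pp. 515–516] [cite: RusinSverak2011, §4 p. 6] -/
theorem caloric_remainder_energy_inequality
    (hNS : IsDistributionalNSSolutionOn Ω ν 0 u p)
    (hG : HasWeakSpatialGradientOn Ω u G)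
    (hG2 : ∀ K ⊆ (Ω : Set (ℝ × E)), IsCompact K →
      ∫⁻ z in K, ENNReal.ofReal (frobeniusNormSq (G z.1 z.2)) < ∞)
    (hLEI : ∀ φ : ℝ → E → ℝ, IsSpaceTimeTestOn Ω φ → (∀ t x, 0 ≤ φ t x) →
      2 * ν * ∫ t, ∫ x, frobeniusNormSq (G t x) * φ t x ≤
        ∫ t, ∫ x, (‖u t x‖ ^ 2 * (timeDeriv φ t x + ν * Δ (φ t) x) +
          (‖u t x‖ ^ 2 + 2 * p t x) * ⟪u t x, gradient (φ t) x⟫ +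
          2 * ⟪(0 : ℝ → E → E) t x, u t x⟫ * φ t x))
    (hu3 : ∀ K ⊆ (Ω : Set (ℝ × E)), IsCompact K → MemLp (uncurry u) 3 (volume.restrict K))
    (hp32 : ∀ K ⊆ (Ω : Set (ℝ × E)), IsCompact K → MemLp (uncurry p) (3 / 2) (volume.restrict K))
    (he : ContDiff ℝ (⊤ : ℕ∞) (uncurry e))
    (hheat : ∀ z ∈ (Ω : Set (ℝ × E)), HasDerivAt (fun s => e s z.2) (ν • (Δ (e z.1)) z.2) z.1)
    (hdiv : ∀ t, VectorCalculus.IsDivFree (e t))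
    (hφ : IsSpaceTimeTestOn Ω φ) (hφ0 : ∀ t x, 0 ≤ φ t x) (hν : 0 < ν) :
    ν * ∫ t, ∫ x, frobeniusNormSq (G t x - fderiv ℝ (e t) x) * φ t x ≤
      (∫ t, ∫ x, ‖u t x - e t x‖ ^ 2 * (timeDeriv φ t x + ν * Δ (φ t) x)) +
        (∫ t, ∫ x, (‖u t x - e t x‖ ^ 2 - ‖e t x‖ ^ 2) * ⟪u t x, gradient (φ t) x⟫) +
        2 * (∫ t, ∫ x, p t x * ⟪u t x - e t x, gradient (φ t) x⟫) +
        2 * (∫ t, ∫ x, φ t x * (‖fderiv ℝ (e t) x‖ * ‖u t x - e t x‖ ^ 2)) +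
        1 / ν * (∫ t, ∫ x, φ t x * ‖e t x‖ ^ 4) +
        (∫ t, ∫ x, ‖e t x‖ ^ 2 * ⟪u t x - e t x, gradient (φ t) x⟫) +
        2 * (∫ t, ∫ x, ⟪e t x, gradient (φ t) x⟫ * ⟪e t x, u t x - e t x⟫) +
        ∫ t, ∫ x, ⟪e t x, gradient (φ t) x⟫ * ‖e t x‖ ^ 2 := by
  have h4 := caloric_remainder_local_energy_inequality hNS hG hG2 hLEI hu3 hp32 he hheat hdiv hφ hφ0
  haveI : (volume : Measure (ℝ × E)).IsAddHaarMeasure := Measure.prod.instIsAddHaarMeasure _ _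
  haveI hHT31 : ENNReal.HolderTriple (3 / 2) 3 1 := by
    refine ⟨?_⟩
    rw [ENNReal.inv_div (Or.inr (by norm_num)) (Or.inr (by norm_num)), inv_one,
      show (3 : ℝ≥0∞)⁻¹ = 1 / 3 by rw [one_div], ENNReal.div_add_div_same,
      show (2 : ℝ≥0∞) + 1 = 3 by norm_num, ENNReal.div_self (by norm_num) (by norm_num)]
  set b := stdOrthonormalBasis ℝ E with hb
  -- ### (0) smoothness and continuity of the weights
  have hes : IsSmoothSpaceTimeOn univ e := IsSmoothSpaceTimeOn.of_contDiff_univ he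
  have hφs : IsSmoothSpaceTimeOn univ φ := hφ.isSmoothSpaceTimeOn univ
  have he_c : Continuous fun z : ℝ × E => e z.1 z.2 := hes.continuous_of_univ
  have hφ_c : Continuous fun z : ℝ × E => φ z.1 z.2 := hφs.continuous_of_univ
  have hLe_c : Continuous fun z : ℝ × E => (Δ (e z.1)) z.2 :=
    (hes.laplacian uniqueDiffOn_univ).continuous_of_univ
  have hLφ_c : Continuous fun z : ℝ × E => (Δ (φ z.1)) z.2 :=
    (hφs.laplacian uniqueDiffOn_univ).continuous_of_univ
  have hDes : IsSmoothSpaceTimeOn univ fun t x => fderiv ℝ (e t) x := hes.fderiv_slice uniqueDiffOn_univ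
  have hDe_c : Continuous fun z : ℝ × E => fderiv ℝ (e z.1) z.2 := hDes.continuous_of_univ
  have hgφ_c : Continuous fun z : ℝ × E => gradient (φ z.1) z.2 :=
    (hφs.gradient uniqueDiffOn_univ).continuous_of_univ
  have hφt_c : Continuous fun z : ℝ × E => timeDeriv φ z.1 z.2 := hφ.continuous_timeDeriv
  have hfrob_c : Continuous fun L : E →L[ℝ] E => frobeniusNormSq L := by
    have : (fun L : E →L[ℝ] E => frobeniusNormSq L) = fun L => ∑ i, ‖L (b i)‖ ^ 2 :=
      funext fun L => frobeniusNormSq_eq_sum b L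
    rw [this]
    exact continuous_finsetSum _ fun i _ =>
      ((ContinuousLinearMap.apply ℝ E (b i)).continuous.norm).pow 2
  have he2 : ∀ t, ContDiff ℝ 2 (e t) := fun t => contDiff_infty.1 (contDiff_slice_field (F := E) he t) 2
  have he1 : ∀ t, ContDiff ℝ 1 (e t) := fun t => (he2 t).of_le one_le_two
  have hed : ∀ t x, DifferentiableAt ℝ (e t) x := fun t x => (he1 t).differentiable one_ne_zero x
  have hφ2 : ∀ t, ContDiff ℝ 2 (φ t) := fun t => contDiff_infty.1 (hφ.contDiff_slice t) 2
  have hφd : ∀ t x, DifferentiableAt ℝ (φ t) x := fun t x =>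
    ((hφ2 t).differentiable (by norm_num)) x
  -- ### (1) the support and the classes of `u`, `p`, `G` on it
  set K : Set (ℝ × E) := tsupport (uncurry φ) with hK
  have hKc : IsCompact K := hφ.hasCompactSupport
  have hKΩ : K ⊆ (Ω : Set (ℝ × E)) := hφ.tsupport_subset
  have hKm : MeasurableSet K := hKc.measurableSet
  haveI hKfin : IsFiniteMeasure (volume.restrict K) := ⟨by
    rw [Measure.restrict_apply_univ]; exact hKc.measure_lt_top⟩
  have hφK : ∀ z : ℝ × E, z ∉ K → φ z.1 z.2 = 0 := fun z hz =>
    image_eq_zero_of_notMem_tsupport (f := uncurry φ) hz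
  have hφtK : ∀ z : ℝ × E, z ∉ K → timeDeriv φ z.1 z.2 = 0 := fun z hz =>
    IsSpaceTimeTestOn.timeDeriv_eq_zero_of_notMem hz
  have hnear : ∀ z : ℝ × E, z ∉ K → φ z.1 =ᶠ[𝓝 z.2] fun _ => (0 : ℝ) := fun z hz => by
    have h0 : uncurry φ =ᶠ[𝓝 (z.1, z.2)] 0 := notMem_tsupport_iff_eventuallyEq.1 hz
    have hc : Continuous fun y : E => (z.1, y) := continuous_const.prodMk continuous_id
    exact (hc.tendsto z.2).eventually h0
  have hgφK : ∀ z : ℝ × E, z ∉ K → gradient (φ z.1) z.2 = 0 := fun z hz => by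
    rw [gradient, (hnear z hz).fderiv_eq, fderiv_fun_const, Pi.zero_apply, map_zero]
  have hLφK : ∀ z : ℝ × E, z ∉ K → (Δ (φ z.1)) z.2 = 0 := fun z hz => by
    rw [(InnerProductSpace.laplacian_congr_nhds (hnear z hz)).self_of_nhds,
      InnerProductSpace.laplacian_const, Pi.zero_apply]
  -- the classes
  have huK : MemLp (uncurry u) 3 (volume.restrict K) := hu3 K hKΩ hKc
  have hpK : MemLp (uncurry p) (3 / 2) (volume.restrict K) := hp32 K hKΩ hKc
  have hum : AEStronglyMeasurable (uncurry u) (volume.restrict K) := huK.aestronglyMeasurable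
  have hpm : AEStronglyMeasurable (uncurry p) (volume.restrict K) := hpK.aestronglyMeasurable
  have hGm : AEStronglyMeasurable (uncurry G) (volume.restrict K) :=
    (hG.locallyIntegrableOn_grad.aestronglyMeasurable).mono_measure (Measure.restrict_mono hKΩ le_rfl)
  have hum' : AEStronglyMeasurable (fun z : ℝ × E => u z.1 z.2) (volume.restrict K) := hum
  have hpm' : AEStronglyMeasurable (fun z : ℝ × E => p z.1 z.2) (volume.restrict K) := hpm
  have hGm' : AEStronglyMeasurable (fun z : ℝ × E => G z.1 z.2) (volume.restrict K) := hGm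
  have hu2K : MemLp (uncurry u) 2 (volume.restrict K) := huK.mono_exponent (by norm_num)
  -- integrable dominating functions on `K`
  have gU2 : IntegrableOn (fun z : ℝ × E => ‖u z.1 z.2‖ ^ 2) K volume :=
    hu2K.integrable_norm_pow two_ne_zero
  have gU3 : IntegrableOn (fun z : ℝ × E => ‖u z.1 z.2‖ ^ 3) K volume :=
    huK.integrable_norm_pow (by norm_num)
  have gU1 : IntegrableOn (fun z : ℝ × E => ‖u z.1 z.2‖) K volume :=
    (huK.integrable (by norm_num)).norm
  have h1le32 : (1 : ℝ≥0∞) ≤ 3 / 2 := by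
    rw [ENNReal.le_div_iff_mul_le (Or.inl (by norm_num)) (Or.inl (by norm_num))]
    norm_num
  have gP1 : IntegrableOn (fun z : ℝ × E => ‖p z.1 z.2‖) K volume :=
    (hpK.integrable h1le32).norm
  have gPU : IntegrableOn (fun z : ℝ × E => ‖p z.1 z.2‖ * ‖u z.1 z.2‖) K volume := by
    have h := MemLp.mul' (r := 1) (f := fun z : ℝ × E => ‖u z.1 z.2‖)
      (φ := fun z : ℝ × E => ‖p z.1 z.2‖) huK.norm hpK.norm
    exact memLp_one_iff_integrable.1 h
  have gG2 : IntegrableOn (fun z : ℝ × E => frobeniusNormSq (G z.1 z.2)) K volume := by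
    refine ⟨(hfrob_c.comp_aestronglyMeasurable hGm'), ?_⟩
    have hfin := hG2 K hKΩ hKc
    refine lt_of_le_of_lt (lintegral_mono fun z => ?_) hfin
    rw [Real.enorm_eq_ofReal (frobeniusNormSq_nonneg _)]
  have gGi : ∀ i, IntegrableOn (fun z : ℝ × E => ‖G z.1 z.2 (b i)‖) K volume := by
    intro i
    have hmeas : AEStronglyMeasurable (fun z : ℝ × E => G z.1 z.2 (b i)) (volume.restrict K) :=
      (ContinuousLinearMap.apply ℝ E (b i)).continuous.comp_aestronglyMeasurable hGm'
    have h2 : MemLp (fun z : ℝ × E => G z.1 z.2 (b i)) 2 (volume.restrict K) := by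
      refine (memLp_two_iff_integrable_sq_norm hmeas).2 ?_
      refine Integrable.mono' gG2 (hmeas.norm.pow 2) (Eventually.of_forall fun z => ?_)
      rw [Real.norm_eq_abs, abs_of_nonneg (sq_nonneg _)]
      exact norm_apply_sq_le_frobeniusNormSq b _ i
    exact (h2.integrable one_le_two).norm
  -- bounds of the weights on `K`
  obtain ⟨Cφ, hCφ0, hCφ⟩ := exists_forall_mem_norm_le_of_continuous hKc hφ_c
  obtain ⟨Cφt, hCφt0, hCφt⟩ := exists_forall_mem_norm_le_of_continuous hKc hφt_c
  obtain ⟨CLφ, hCLφ0, hCLφ⟩ := exists_forall_mem_norm_le_of_continuous hKc hLφ_c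
  obtain ⟨Cgφ, hCgφ0, hCgφ⟩ := exists_forall_mem_norm_le_of_continuous hKc hgφ_c
  obtain ⟨Ce, hCe0, hCe⟩ := exists_forall_mem_norm_le_of_continuous hKc he_c
  obtain ⟨CDe, hCDe0, hCDe⟩ := exists_forall_mem_norm_le_of_continuous hKc hDe_c
  obtain ⟨CLe, hCLe0, hCLe⟩ := exists_forall_mem_norm_le_of_continuous hKc hLe_c
  have hDeu : AEStronglyMeasurable (fun z : ℝ × E => fderiv ℝ (e z.1) z.2 (u z.1 z.2))
      (volume.restrict K) :=
    (isBoundedBilinearMap_apply (𝕜 := ℝ) (E := E) (F := E)).continuous.comp_aestronglyMeasurable₂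
      hDe_c.aestronglyMeasurable hum'
  have iP3 : Integrable (fun z : ℝ × E =>
      φ z.1 z.2 * ⟪fderiv ℝ (e z.1) z.2 (u z.1 z.2), u z.1 z.2⟫) volume := by
    refine integrable_of_bound_on_compact hKc (gU2.const_mul (Cφ * CDe))
      (hφ_c.aestronglyMeasurable.mul (hDeu.inner hum'))
      (fun z hz => by rw [hφK z hz, zero_mul]) fun z hz => ?_
    rw [norm_mul]
    calc ‖φ z.1 z.2‖ * ‖⟪fderiv ℝ (e z.1) z.2 (u z.1 z.2), u z.1 z.2⟫‖
        ≤ Cφ * ((CDe * ‖u z.1 z.2‖) * ‖u z.1 z.2‖) :=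
          mul_le_mul (hCφ z hz) ((norm_inner_le_norm _ _).trans (mul_le_mul_of_nonneg_right
            ((ContinuousLinearMap.le_opNorm _ _).trans (mul_le_mul_of_nonneg_right (hCDe z hz)
            (norm_nonneg _))) (norm_nonneg _))) (norm_nonneg _) hCφ0
      _ = Cφ * CDe * ‖u z.1 z.2‖ ^ 2 := by ring
  -- the classes of `w = u - e` on `K`
  have hwm' : AEStronglyMeasurable (fun z : ℝ × E => u z.1 z.2 - e z.1 z.2) (volume.restrict K) :=
    hum'.sub he_c.aestronglyMeasurable
  have gW2 : IntegrableOn (fun z : ℝ × E => ‖u z.1 z.2 - e z.1 z.2‖ ^ 2) K volume := by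
    refine Integrable.mono' ((gU2.const_mul 2).add (integrableOn_const (C := 2 * Ce ^ 2)
      (hs := hKc.measure_lt_top.ne) |>.integrable)) (hwm'.norm.pow 2) ?_
    refine (ae_restrict_iff' hKm).2 (Eventually.of_forall fun z hz => ?_)
    rw [Real.norm_eq_abs, abs_of_nonneg (sq_nonneg _)]
    calc ‖u z.1 z.2 - e z.1 z.2‖ ^ 2 ≤ (‖u z.1 z.2‖ + ‖e z.1 z.2‖) ^ 2 := by
          gcongr; exact norm_sub_le _ _
      _ ≤ 2 * ‖u z.1 z.2‖ ^ 2 + 2 * ‖e z.1 z.2‖ ^ 2 := by nlinarith [sq_nonneg (‖u z.1 z.2‖ - ‖e z.1 z.2‖)]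
      _ ≤ 2 * ‖u z.1 z.2‖ ^ 2 + 2 * Ce ^ 2 := by
          have := hCe z hz
          nlinarith [norm_nonneg (e z.1 z.2)]
  -- ### integrands of the expansion
  have hDw_c : AEStronglyMeasurable (fun z : ℝ × E => fderiv ℝ (e z.1) z.2 (u z.1 z.2 - e z.1 z.2))
      (volume.restrict K) :=
    (isBoundedBilinearMap_apply (𝕜 := ℝ) (E := E) (F := E)).continuous.comp_aestronglyMeasurable₂
      hDe_c.aestronglyMeasurable hwm'
  have hDee_c : Continuous fun z : ℝ × E => fderiv ℝ (e z.1) z.2 (e z.1 z.2) := hDe_c.clm_apply he_c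
  -- `φ ⟪De(w), w⟫`, `φ ⟪De(w), e⟫`, `φ ⟪De(e), w⟫`, `φ ⟪De(e), e⟫`
  have iT1 : Integrable (fun z : ℝ × E =>
      φ z.1 z.2 * ⟪fderiv ℝ (e z.1) z.2 (u z.1 z.2 - e z.1 z.2), u z.1 z.2 - e z.1 z.2⟫) volume := by
    refine integrable_of_bound_on_compact hKc (gW2.const_mul (Cφ * CDe))
      (hφ_c.aestronglyMeasurable.mul (hDw_c.inner hwm'))
      (fun z hz => by rw [hφK z hz, zero_mul]) fun z hz => ?_
    rw [norm_mul]
    calc ‖φ z.1 z.2‖ * ‖⟪fderiv ℝ (e z.1) z.2 (u z.1 z.2 - e z.1 z.2), u z.1 z.2 - e z.1 z.2⟫‖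
        ≤ Cφ * ((CDe * ‖u z.1 z.2 - e z.1 z.2‖) * ‖u z.1 z.2 - e z.1 z.2‖) :=
          mul_le_mul (hCφ z hz) ((norm_inner_le_norm _ _).trans (mul_le_mul_of_nonneg_right
            ((ContinuousLinearMap.le_opNorm _ _).trans (mul_le_mul_of_nonneg_right (hCDe z hz)
            (norm_nonneg _))) (norm_nonneg _))) (norm_nonneg _) hCφ0
      _ = Cφ * CDe * ‖u z.1 z.2 - e z.1 z.2‖ ^ 2 := by ring
  have iD2 : Integrable (fun z : ℝ × E =>
      φ z.1 z.2 * ⟪fderiv ℝ (e z.1) z.2 (u z.1 z.2 - e z.1 z.2), e z.1 z.2⟫) volume := by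
    have gW1 : IntegrableOn (fun z : ℝ × E => ‖u z.1 z.2 - e z.1 z.2‖) K volume :=
      Integrable.mono' (gU1.add (integrableOn_const (C := Ce) (hs := hKc.measure_lt_top.ne)
        |>.integrable)) hwm'.norm ((ae_restrict_iff' hKm).2 (Eventually.of_forall fun z hz => by
          rw [norm_norm]; exact (norm_sub_le _ _).trans (add_le_add le_rfl (hCe z hz))))
    refine integrable_of_bound_on_compact hKc (gW1.const_mul (Cφ * CDe * Ce))
      (hφ_c.aestronglyMeasurable.mul (hDw_c.inner he_c.aestronglyMeasurable))
      (fun z hz => by rw [hφK z hz, zero_mul]) fun z hz => ?_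
    rw [norm_mul]
    calc ‖φ z.1 z.2‖ * ‖⟪fderiv ℝ (e z.1) z.2 (u z.1 z.2 - e z.1 z.2), e z.1 z.2⟫‖
        ≤ Cφ * ((CDe * ‖u z.1 z.2 - e z.1 z.2‖) * Ce) :=
          mul_le_mul (hCφ z hz) ((norm_inner_le_norm _ _).trans (mul_le_mul
            ((ContinuousLinearMap.le_opNorm _ _).trans (mul_le_mul_of_nonneg_right (hCDe z hz)
            (norm_nonneg _))) (hCe z hz) (norm_nonneg _) (by positivity))) (norm_nonneg _) hCφ0
      _ = Cφ * CDe * Ce * ‖u z.1 z.2 - e z.1 z.2‖ := by ring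
  have iT2 : Integrable (fun z : ℝ × E =>
      φ z.1 z.2 * ⟪fderiv ℝ (e z.1) z.2 (e z.1 z.2), u z.1 z.2 - e z.1 z.2⟫) volume := by
    have gW1 : IntegrableOn (fun z : ℝ × E => ‖u z.1 z.2 - e z.1 z.2‖) K volume :=
      Integrable.mono' (gU1.add (integrableOn_const (C := Ce) (hs := hKc.measure_lt_top.ne)
        |>.integrable)) hwm'.norm ((ae_restrict_iff' hKm).2 (Eventually.of_forall fun z hz => by
          rw [norm_norm]; exact (norm_sub_le _ _).trans (add_le_add le_rfl (hCe z hz))))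
    refine integrable_of_bound_on_compact hKc (gW1.const_mul (Cφ * (CDe * Ce)))
      (hφ_c.aestronglyMeasurable.mul (hDee_c.aestronglyMeasurable.inner hwm'))
      (fun z hz => by rw [hφK z hz, zero_mul]) fun z hz => ?_
    rw [norm_mul]
    calc ‖φ z.1 z.2‖ * ‖⟪fderiv ℝ (e z.1) z.2 (e z.1 z.2), u z.1 z.2 - e z.1 z.2⟫‖
        ≤ Cφ * ((CDe * Ce) * ‖u z.1 z.2 - e z.1 z.2‖) :=
          mul_le_mul (hCφ z hz) ((norm_inner_le_norm _ _).trans (mul_le_mul_of_nonneg_right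
            ((ContinuousLinearMap.le_opNorm _ _).trans (mul_le_mul (hCDe z hz) (hCe z hz)
            (norm_nonneg _) hCDe0)) (norm_nonneg _))) (norm_nonneg _) hCφ0
      _ = Cφ * (CDe * Ce) * ‖u z.1 z.2 - e z.1 z.2‖ := by ring
  have hint : ∀ {f : ℝ × E → ℝ}, Continuous f → (∀ z ∉ K, f z = 0) → Integrable f volume :=
    fun hf h0 => hf.integrable_of_hasCompactSupport (HasCompactSupport.intro hKc h0)
  have iD3 : Integrable (fun z : ℝ × E => φ z.1 z.2 * ⟪fderiv ℝ (e z.1) z.2 (e z.1 z.2), e z.1 z.2⟫) volume :=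
    hint (hφ_c.mul (hDee_c.inner he_c)) fun z hz => by rw [hφK z hz, zero_mul]
  -- the splitting `⟪De(u), u⟫ = ⟪De(w), w⟫ + ⟪De(w), e⟫ + ⟪De(e), w⟫ + ⟪De(e), e⟫`
  have hP3_pt : ∀ z : ℝ × E, φ z.1 z.2 * ⟪fderiv ℝ (e z.1) z.2 (u z.1 z.2), u z.1 z.2⟫ =
      φ z.1 z.2 * ⟪fderiv ℝ (e z.1) z.2 (u z.1 z.2 - e z.1 z.2), u z.1 z.2 - e z.1 z.2⟫ +
        (φ z.1 z.2 * ⟪fderiv ℝ (e z.1) z.2 (u z.1 z.2 - e z.1 z.2), e z.1 z.2⟫ +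
        (φ z.1 z.2 * ⟪fderiv ℝ (e z.1) z.2 (e z.1 z.2), u z.1 z.2 - e z.1 z.2⟫ +
        φ z.1 z.2 * ⟪fderiv ℝ (e z.1) z.2 (e z.1 z.2), e z.1 z.2⟫)) := by
    intro z
    have hu : u z.1 z.2 = (u z.1 z.2 - e z.1 z.2) + e z.1 z.2 := (sub_add_cancel _ _).symm
    conv_lhs => rw [hu]
    simp only [map_add, inner_add_left, inner_add_right]
    ring
  have hP3 : ∫ t, ∫ x, φ t x * ⟪fderiv ℝ (e t) x (u t x), u t x⟫ =
      (∫ z : ℝ × E, φ z.1 z.2 * ⟪fderiv ℝ (e z.1) z.2 (u z.1 z.2 - e z.1 z.2), u z.1 z.2 - e z.1 z.2⟫) +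
      ((∫ z : ℝ × E, φ z.1 z.2 * ⟪fderiv ℝ (e z.1) z.2 (u z.1 z.2 - e z.1 z.2), e z.1 z.2⟫) +
      ((∫ z : ℝ × E, φ z.1 z.2 * ⟪fderiv ℝ (e z.1) z.2 (e z.1 z.2), u z.1 z.2 - e z.1 z.2⟫) +
      ∫ z : ℝ × E, φ z.1 z.2 * ⟪fderiv ℝ (e z.1) z.2 (e z.1 z.2), e z.1 z.2⟫)) := by
    rw [← integral_prod (μ := volume) (ν := volume) _ iP3]
    change ∫ z : ℝ × E, φ z.1 z.2 * ⟪fderiv ℝ (e z.1) z.2 (u z.1 z.2), u z.1 z.2⟫ = _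
    have i34 : Integrable (fun z : ℝ × E =>
        φ z.1 z.2 * ⟪fderiv ℝ (e z.1) z.2 (e z.1 z.2), u z.1 z.2 - e z.1 z.2⟫ +
        φ z.1 z.2 * ⟪fderiv ℝ (e z.1) z.2 (e z.1 z.2), e z.1 z.2⟫) volume := iT2.add iD3
    have i234 : Integrable (fun z : ℝ × E =>
        φ z.1 z.2 * ⟪fderiv ℝ (e z.1) z.2 (u z.1 z.2 - e z.1 z.2), e z.1 z.2⟫ +
        (φ z.1 z.2 * ⟪fderiv ℝ (e z.1) z.2 (e z.1 z.2), u z.1 z.2 - e z.1 z.2⟫ +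
        φ z.1 z.2 * ⟪fderiv ℝ (e z.1) z.2 (e z.1 z.2), e z.1 z.2⟫)) volume := iD2.add i34
    rw [funext hP3_pt, integral_add iT1 i234, integral_add iD2 i34, integral_add iT2 iD3]
  -- ### (ii) weak divergence-freeness tested with `θ = ½ |e|² φ`
  have hθs : ContDiff ℝ ((⊤ : ℕ∞) : WithTop ℕ∞) (uncurry fun t x => (1 / 2 : ℝ) * ‖e t x‖ ^ 2) := by
    have : (uncurry fun t x => (1 / 2 : ℝ) * ‖e t x‖ ^ 2) = fun z => (1 / 2 : ℝ) * ‖uncurry e z‖ ^ 2 := rfl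
    rw [this]
    exact contDiff_const.mul (he.norm_sq (𝕜 := ℝ))
  have hθ : IsSpaceTimeTestOn Ω fun t x => φ t x * ((1 / 2 : ℝ) * ‖e t x‖ ^ 2) := hφ.mul_smooth hθs
  have hgradθ : ∀ t x (v : E), ⟪v, gradient (fun y => φ t y * ((1 / 2 : ℝ) * ‖e t y‖ ^ 2)) x⟫ =
      φ t x * ⟪fderiv ℝ (e t) x v, e t x⟫ + (1 / 2 : ℝ) * ‖e t x‖ ^ 2 * ⟪v, gradient (φ t) x⟫ := by
    intro t x v
    have hn2 : DifferentiableAt ℝ (fun y => ‖e t y‖ ^ 2) x := (hed t x).norm_sq (𝕜 := ℝ)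
    have hn : DifferentiableAt ℝ (fun y => (1 / 2 : ℝ) * ‖e t y‖ ^ 2) x := hn2.const_mul _
    rw [real_inner_comm, gradient, InnerProductSpace.toDual_symm_apply, fderiv_fun_mul (hφd t x) hn,
      fderiv_const_mul hn2]
    have h2 : fderiv ℝ (fun y => ‖e t y‖ ^ 2) x v = 2 * ⟪fderiv ℝ (e t) x v, e t x⟫ := by
      have : (fun y => ‖e t y‖ ^ 2) = fun y => ⟪e t y, e t y⟫ := funext fun y =>
        (real_inner_self_eq_norm_sq _).symm
      rw [this, fderiv_inner_apply ℝ (hed t x) (hed t x), real_inner_comm (e t x)]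
      ring
    simp only [_root_.add_apply, _root_.FunLike.coe_smul, Pi.smul_apply, smul_eq_mul, h2]
    rw [real_inner_comm (gradient (φ t) x), gradient, InnerProductSpace.toDual_symm_apply]
    ring
  -- for `u` (weakly divergence free on `Ω`)
  have i_ue : Integrable (fun z : ℝ × E => (1 / 2 : ℝ) * ‖e z.1 z.2‖ ^ 2 * ⟪u z.1 z.2, gradient (φ z.1) z.2⟫)
      volume := by
    refine integrable_of_bound_on_compact hKc (gU1.const_mul ((1 / 2 : ℝ) * Ce ^ 2 * Cgφ))
      ((continuous_const.mul (he_c.norm.pow 2)).aestronglyMeasurable.mul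
        (hum'.inner hgφ_c.aestronglyMeasurable))
      (fun z hz => by rw [hgφK z hz, inner_zero_right, mul_zero]) fun z hz => ?_
    rw [norm_mul, norm_mul, Real.norm_eq_abs, abs_of_nonneg (by norm_num : (0 : ℝ) ≤ 1 / 2),
      Real.norm_eq_abs, abs_of_nonneg (sq_nonneg _)]
    calc (1 / 2 : ℝ) * ‖e z.1 z.2‖ ^ 2 * ‖⟪u z.1 z.2, gradient (φ z.1) z.2⟫‖
        ≤ (1 / 2 : ℝ) * Ce ^ 2 * (‖u z.1 z.2‖ * Cgφ) := by
          refine mul_le_mul (mul_le_mul_of_nonneg_left ?_ (by norm_num)) ((norm_inner_le_norm _ _).trans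
            (mul_le_mul_of_nonneg_left (hCgφ z hz) (norm_nonneg _))) (norm_nonneg _) (by positivity)
          have := hCe z hz
          exact pow_le_pow_left₀ (norm_nonneg _) this 2
      _ = (1 / 2 : ℝ) * Ce ^ 2 * Cgφ * ‖u z.1 z.2‖ := by ring
  have iP3u : Integrable (fun z : ℝ × E => φ z.1 z.2 * ⟪fderiv ℝ (e z.1) z.2 (u z.1 z.2), e z.1 z.2⟫)
      volume := by
    refine integrable_of_bound_on_compact hKc (gU1.const_mul (Cφ * CDe * Ce))
      (hφ_c.aestronglyMeasurable.mul (hDeu.inner he_c.aestronglyMeasurable))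
      (fun z hz => by rw [hφK z hz, zero_mul]) fun z hz => ?_
    rw [norm_mul]
    calc ‖φ z.1 z.2‖ * ‖⟪fderiv ℝ (e z.1) z.2 (u z.1 z.2), e z.1 z.2⟫‖
        ≤ Cφ * ((CDe * ‖u z.1 z.2‖) * Ce) :=
          mul_le_mul (hCφ z hz) ((norm_inner_le_norm _ _).trans (mul_le_mul
            ((ContinuousLinearMap.le_opNorm _ _).trans (mul_le_mul_of_nonneg_right (hCDe z hz)
            (norm_nonneg _))) (hCe z hz) (norm_nonneg _) (by positivity))) (norm_nonneg _) hCφ0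
      _ = Cφ * CDe * Ce * ‖u z.1 z.2‖ := by ring
  have hD_u : (∫ z : ℝ × E, φ z.1 z.2 * ⟪fderiv ℝ (e z.1) z.2 (u z.1 z.2), e z.1 z.2⟫) +
      ∫ z : ℝ × E, (1 / 2 : ℝ) * ‖e z.1 z.2‖ ^ 2 * ⟪u z.1 z.2, gradient (φ z.1) z.2⟫ = 0 := by
    have h0 := hNS.2.2.2.1 _ hθ
    rw [setIntegral_eq_integral_of_forall_compl_eq_zero (fun z hz => by
      have hzK : z ∉ K := fun h => hz (hKΩ h)
      rw [hgradθ, hφK z hzK, hgφK z hzK, inner_zero_right, zero_mul, mul_zero, add_zero])] at h0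
    simp only [hgradθ] at h0
    rwa [integral_add iP3u i_ue] at h0
  -- for `e` (classically divergence free), slice by slice
  have hD_e : (∫ z : ℝ × E, φ z.1 z.2 * ⟪fderiv ℝ (e z.1) z.2 (e z.1 z.2), e z.1 z.2⟫) +
      ∫ z : ℝ × E, (1 / 2 : ℝ) * ‖e z.1 z.2‖ ^ 2 * ⟪e z.1 z.2, gradient (φ z.1) z.2⟫ = 0 := by
    have i_ee : Integrable (fun z : ℝ × E => (1 / 2 : ℝ) * ‖e z.1 z.2‖ ^ 2 * ⟪e z.1 z.2, gradient (φ z.1) z.2⟫)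
        volume := hint ((continuous_const.mul (he_c.norm.pow 2)).mul (he_c.inner hgφ_c))
          fun z hz => by rw [hgφK z hz, inner_zero_right, mul_zero]
    have isum : Integrable (fun z : ℝ × E => φ z.1 z.2 * ⟪fderiv ℝ (e z.1) z.2 (e z.1 z.2), e z.1 z.2⟫ +
        (1 / 2 : ℝ) * ‖e z.1 z.2‖ ^ 2 * ⟪e z.1 z.2, gradient (φ z.1) z.2⟫) volume := iD3.add i_ee
    rw [← integral_add iD3 i_ee, Measure.volume_eq_prod, integral_prod _ isum]
    refine integral_eq_zero_of_ae (Eventually.of_forall fun t => ?_)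
    dsimp only
    have hθ1 : ContDiff ℝ 1 fun y => φ t y * ((1 / 2 : ℝ) * ‖e t y‖ ^ 2) :=
      contDiff_infty.1 ((hθ.contDiff_slice t)) 1
    have key := integral_mul_divergence_add_eq_zero_left hθ1 (he1 t) ((hφ.hasCompactSupport_slice t).mul_right)
    simp only [hdiv t _, mul_zero, integral_zero, zero_add, hgradθ] at key
    exact key
  -- hence for `w`
  have hD2 : ∫ z : ℝ × E, φ z.1 z.2 * ⟪fderiv ℝ (e z.1) z.2 (u z.1 z.2 - e z.1 z.2), e z.1 z.2⟫ =
      -(1 / 2 : ℝ) * ∫ z : ℝ × E, ‖e z.1 z.2‖ ^ 2 * ⟪u z.1 z.2 - e z.1 z.2, gradient (φ z.1) z.2⟫ := by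
    have i_ee : Integrable (fun z : ℝ × E => (1 / 2 : ℝ) * ‖e z.1 z.2‖ ^ 2 * ⟪e z.1 z.2, gradient (φ z.1) z.2⟫)
        volume := hint ((continuous_const.mul (he_c.norm.pow 2)).mul (he_c.inner hgφ_c))
          fun z hz => by rw [hgφK z hz, inner_zero_right, mul_zero]
    have e1 : (fun z : ℝ × E => φ z.1 z.2 * ⟪fderiv ℝ (e z.1) z.2 (u z.1 z.2 - e z.1 z.2), e z.1 z.2⟫) =
        fun z : ℝ × E => φ z.1 z.2 * ⟪fderiv ℝ (e z.1) z.2 (u z.1 z.2), e z.1 z.2⟫ -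
          φ z.1 z.2 * ⟪fderiv ℝ (e z.1) z.2 (e z.1 z.2), e z.1 z.2⟫ := by
      funext z; rw [map_sub, inner_sub_left]; ring
    have e2 : (fun z : ℝ × E => ‖e z.1 z.2‖ ^ 2 * ⟪u z.1 z.2 - e z.1 z.2, gradient (φ z.1) z.2⟫) =
        fun z : ℝ × E => 2 * ((1 / 2 : ℝ) * ‖e z.1 z.2‖ ^ 2 * ⟪u z.1 z.2, gradient (φ z.1) z.2⟫) -
          2 * ((1 / 2 : ℝ) * ‖e z.1 z.2‖ ^ 2 * ⟪e z.1 z.2, gradient (φ z.1) z.2⟫) := by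
      funext z; rw [inner_sub_left]; ring
    rw [e1, e2, integral_sub iP3u iD3, integral_sub (i_ue.const_mul 2) (i_ee.const_mul 2),
      integral_const_mul, integral_const_mul]
    linarith
  have hD3 : ∫ z : ℝ × E, φ z.1 z.2 * ⟪fderiv ℝ (e z.1) z.2 (e z.1 z.2), e z.1 z.2⟫ =
      -(1 / 2 : ℝ) * ∫ z : ℝ × E, ⟪e z.1 z.2, gradient (φ z.1) z.2⟫ * ‖e z.1 z.2‖ ^ 2 := by
    have i_ee : Integrable (fun z : ℝ × E => (1 / 2 : ℝ) * ‖e z.1 z.2‖ ^ 2 * ⟪e z.1 z.2, gradient (φ z.1) z.2⟫)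
        volume := hint ((continuous_const.mul (he_c.norm.pow 2)).mul (he_c.inner hgφ_c))
          fun z hz => by rw [hgφK z hz, inner_zero_right, mul_zero]
    have e2 : (fun z : ℝ × E => ⟪e z.1 z.2, gradient (φ z.1) z.2⟫ * ‖e z.1 z.2‖ ^ 2) =
        fun z : ℝ × E => 2 * ((1 / 2 : ℝ) * ‖e z.1 z.2‖ ^ 2 * ⟪e z.1 z.2, gradient (φ z.1) z.2⟫) := by
      funext z; ring
    rw [e2, integral_const_mul]
    linarith
  -- ### (iii) the weak-gradient identity for `w` tested with `φ eᵢ eⱼ`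
  set ec : Fin (Module.finrank ℝ E) → ℝ → E → ℝ := fun i t x => ⟪e t x, b i⟫ with hec
  have hec_s : ∀ i, IsSmoothSpaceTimeOn univ (ec i) := fun i =>
    hes.inner (isSmoothSpaceTimeOn_const_time contDiff_const univ)
  have hee_smooth : ∀ i j, ContDiff ℝ ((⊤ : ℕ∞) : WithTop ℕ∞) (uncurry fun t x => ec i t x * ec j t x) := by
    intro i j
    have h1 : IsSmoothSpaceTimeOn univ fun t x => ec i t x * ec j t x := (hec_s i).mul (hec_s j)
    rw [IsSmoothSpaceTimeOn, univ_prod_univ, contDiffOn_univ] at h1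
    exact h1
  have hϑ : ∀ i j, IsSpaceTimeTestOn Ω fun t x => φ t x * (ec i t x * ec j t x) := fun i j =>
    hφ.mul_smooth (hee_smooth i j)
  have hecd : ∀ i t x, DifferentiableAt ℝ (ec i t) x := fun i t x => (hed t x).inner ℝ (differentiableAt_const _)
  have hdec : ∀ i t x (v : E), fderiv ℝ (ec i t) x v = ⟪fderiv ℝ (e t) x v, b i⟫ := by
    intro i t x v
    change fderiv ℝ (fun y => ⟪e t y, b i⟫) x v = _
    rw [fderiv_inner_apply ℝ (hed t x) (differentiableAt_const _)]
    simp
  -- the derivative of `φ eᵢ eⱼ` along `bⱼ`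
  have hdϑ : ∀ i j t x, fderiv ℝ (fun y => φ t y * (ec i t y * ec j t y)) x (b j) =
      fderiv ℝ (φ t) x (b j) * (ec i t x * ec j t x) +
        φ t x * (⟪fderiv ℝ (e t) x (b j), b i⟫ * ec j t x + ec i t x * ⟪fderiv ℝ (e t) x (b j), b j⟫) := by
    intro i j t x
    have hm : DifferentiableAt ℝ (fun y => ec i t y * ec j t y) x := (hecd i t x).mul (hecd j t x)
    rw [fderiv_fun_mul (hφd t x) hm, fderiv_fun_mul (hecd i t x) (hecd j t x)]
    simp only [_root_.add_apply, _root_.FunLike.coe_smul, Pi.smul_apply, smul_eq_mul, hdec]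
    ring
  -- integrability of both sides of the weak-gradient identities
  have hGwm' : AEStronglyMeasurable (fun z : ℝ × E => G z.1 z.2 - fderiv ℝ (e z.1) z.2) (volume.restrict K) :=
    hGm'.sub hDe_c.aestronglyMeasurable
  have gGwj : ∀ j, IntegrableOn (fun z : ℝ × E => ‖(G z.1 z.2 - fderiv ℝ (e z.1) z.2) (b j)‖) K volume := by
    intro j
    refine Integrable.mono' ((gGi j).add (integrableOn_const (C := CDe) (hs := hKc.measure_lt_top.ne)
      |>.integrable)) (((ContinuousLinearMap.apply ℝ E (b j)).continuous.comp_aestronglyMeasurable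
        hGwm').norm) ((ae_restrict_iff' hKm).2 (Eventually.of_forall fun z hz => ?_))
    rw [norm_norm, _root_.sub_apply]
    refine (norm_sub_le _ _).trans (add_le_add le_rfl ?_)
    exact (ContinuousLinearMap.le_opNorm _ _).trans (by rw [b.orthonormal.1 j, mul_one]; exact hCDe z hz)
  have iVij : ∀ i j, Integrable (fun z : ℝ × E =>
      (φ z.1 z.2 * (ec i z.1 z.2 * ec j z.1 z.2)) * ⟪(G z.1 z.2 - fderiv ℝ (e z.1) z.2) (b j), b i⟫)
      volume := by
    intro i j
    have hw_c : Continuous fun z : ℝ × E => φ z.1 z.2 * (ec i z.1 z.2 * ec j z.1 z.2) :=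
      (hϑ i j).contDiff.continuous
    obtain ⟨Cw, hCw0, hCw⟩ := exists_forall_mem_norm_le_of_continuous hKc hw_c
    refine integrable_of_bound_on_compact hKc ((gGwj j).const_mul Cw)
      (hw_c.aestronglyMeasurable.mul
        (((ContinuousLinearMap.apply ℝ E (b j)).continuous.comp_aestronglyMeasurable hGwm').inner
          aestronglyMeasurable_const))
      (fun z hz => by rw [hφK z hz, zero_mul, zero_mul]) fun z hz => ?_
    rw [norm_mul]
    refine mul_le_mul (hCw z hz) ((norm_inner_le_norm _ _).trans ?_) (norm_nonneg _) hCw0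
    rw [b.orthonormal.1 i, mul_one]
  have iUij : ∀ i j, Integrable (fun z : ℝ × E =>
      fderiv ℝ (fun y => φ z.1 y * (ec i z.1 y * ec j z.1 y)) z.2 (b j) * ⟪u z.1 z.2 - e z.1 z.2, b i⟫)
      volume := by
    intro i j
    have hcont : Continuous fun z : ℝ × E => fderiv ℝ (fun y => φ z.1 y * (ec i z.1 y * ec j z.1 y)) z.2 (b j) :=
      (((hϑ i j).mono le_top).fderiv_apply_top (b j)).contDiff.continuous
    have hzero : ∀ z : ℝ × E, z ∉ K →
        fderiv ℝ (fun y => φ z.1 y * (ec i z.1 y * ec j z.1 y)) z.2 (b j) = 0 := by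
      intro z hz
      have hz' : z ∉ tsupport (uncurry fun t x => φ t x * (ec i t x * ec j t x)) := fun h =>
        hz (tsupport_mul_subset_left (f := uncurry φ) (g := uncurry fun t x => ec i t x * ec j t x) h)
      have h0 := IsSpaceTimeTestOn.fderiv_slice_eq_zero_of_notMem
        (ψ := fun t x => φ t x * (ec i t x * ec j t x)) hz'
      change fderiv ℝ (fun y => φ z.1 y * (ec i z.1 y * ec j z.1 y)) z.2 (b j) = 0
      rw [h0, _root_.zero_apply]
    have gW1 : IntegrableOn (fun z : ℝ × E => ‖u z.1 z.2 - e z.1 z.2‖) K volume :=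
      Integrable.mono' (gU1.add (integrableOn_const (C := Ce) (hs := hKc.measure_lt_top.ne)
        |>.integrable)) hwm'.norm ((ae_restrict_iff' hKm).2 (Eventually.of_forall fun z hz => by
          rw [norm_norm]; exact (norm_sub_le _ _).trans (add_le_add le_rfl (hCe z hz))))
    obtain ⟨Cw, hCw0, hCw⟩ := exists_forall_mem_norm_le_of_continuous hKc hcont
    refine integrable_of_bound_on_compact hKc (gW1.const_mul Cw)
      (hcont.aestronglyMeasurable.mul (hwm'.inner aestronglyMeasurable_const))
      (fun z hz => by rw [hzero z hz, zero_mul]) fun z hz => ?_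
    rw [norm_mul]
    refine mul_le_mul (hCw z hz) ((norm_inner_le_norm _ _).trans ?_) (norm_nonneg _) hCw0
    rw [b.orthonormal.1 i, mul_one]
  -- the weak-gradient identity for `w = u - e`: `G` for `u`, classical for `e`
  have hWij : ∀ i j, ∫ z : ℝ × E, fderiv ℝ (fun y => φ z.1 y * (ec i z.1 y * ec j z.1 y)) z.2 (b j) *
      ⟪u z.1 z.2 - e z.1 z.2, b i⟫ =
      -∫ z : ℝ × E, (φ z.1 z.2 * (ec i z.1 z.2 * ec j z.1 z.2)) * ⟪(G z.1 z.2 - fderiv ℝ (e z.1) z.2) (b j), b i⟫ := by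
    intro i j
    have hcont : Continuous fun z : ℝ × E => fderiv ℝ (fun y => φ z.1 y * (ec i z.1 y * ec j z.1 y)) z.2 (b j) :=
      (((hϑ i j).mono le_top).fderiv_apply_top (b j)).contDiff.continuous
    have hw_c : Continuous fun z : ℝ × E => φ z.1 z.2 * (ec i z.1 z.2 * ec j z.1 z.2) :=
      (hϑ i j).contDiff.continuous
    have hzero : ∀ z : ℝ × E, z ∉ K →
        fderiv ℝ (fun y => φ z.1 y * (ec i z.1 y * ec j z.1 y)) z.2 (b j) = 0 := by
      intro z hz
      have hz' : z ∉ tsupport (uncurry fun t x => φ t x * (ec i t x * ec j t x)) := fun h =>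
        hz (tsupport_mul_subset_left (f := uncurry φ) (g := uncurry fun t x => ec i t x * ec j t x) h)
      have h0 := IsSpaceTimeTestOn.fderiv_slice_eq_zero_of_notMem
        (ψ := fun t x => φ t x * (ec i t x * ec j t x)) hz'
      change fderiv ℝ (fun y => φ z.1 y * (ec i z.1 y * ec j z.1 y)) z.2 (b j) = 0
      rw [h0, _root_.zero_apply]
    have iUe : Integrable (fun z : ℝ × E =>
        fderiv ℝ (fun y => φ z.1 y * (ec i z.1 y * ec j z.1 y)) z.2 (b j) * ⟪e z.1 z.2, b i⟫) volume :=
      hint (hcont.mul (he_c.inner continuous_const)) fun z hz => by rw [hzero z hz, zero_mul]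
    have iVe : Integrable (fun z : ℝ × E =>
        (φ z.1 z.2 * (ec i z.1 z.2 * ec j z.1 z.2)) * ⟪fderiv ℝ (e z.1) z.2 (b j), b i⟫) volume :=
      hint (hw_c.mul ((hDe_c.clm_apply continuous_const).inner continuous_const))
        fun z hz => by rw [hφK z hz, zero_mul, zero_mul]
    -- for `e`, slice by slice
    have hE : ∫ z : ℝ × E, fderiv ℝ (fun y => φ z.1 y * (ec i z.1 y * ec j z.1 y)) z.2 (b j) *
        ⟪e z.1 z.2, b i⟫ = -∫ z : ℝ × E, (φ z.1 z.2 * (ec i z.1 z.2 * ec j z.1 z.2)) *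
          ⟪fderiv ℝ (e z.1) z.2 (b j), b i⟫ := by
      rw [Measure.volume_eq_prod, integral_prod _ iUe, integral_prod _ iVe, ← integral_neg]
      refine integral_congr_ae (Eventually.of_forall fun t => ?_)
      dsimp only
      have hϑ1 : ContDiff ℝ 1 fun y => φ t y * (ec i t y * ec j t y) :=
        contDiff_infty.1 ((hϑ i j).contDiff_slice t) 1
      have hϑc : HasCompactSupport fun y => φ t y * (ec i t y * ec j t y) :=
        (hϑ i j).hasCompactSupport_slice t
      have hprod : ContDiff ℝ 1 fun y => (φ t y * (ec i t y * ec j t y)) * ⟪e t y, b i⟫ :=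
        hϑ1.mul ((he1 t).inner ℝ contDiff_const)
      have h0 := integral_fderiv_apply_eq_zero hprod hϑc.mul_right (b j)
      have hpt : ∀ y, fderiv ℝ (fun y => (φ t y * (ec i t y * ec j t y)) * ⟪e t y, b i⟫) y (b j) =
          fderiv ℝ (fun y => φ t y * (ec i t y * ec j t y)) y (b j) * ⟪e t y, b i⟫ +
            (φ t y * (ec i t y * ec j t y)) * ⟪fderiv ℝ (e t) y (b j), b i⟫ := by
        intro y
        rw [fderiv_fun_mul ((hϑ1.differentiable one_ne_zero) y) (hecd i t y)]
        simp only [_root_.add_apply, _root_.FunLike.coe_smul, Pi.smul_apply, smul_eq_mul, hdec]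
        simp only [hec]
        ring
      simp only [hpt] at h0
      have hcA : Continuous fun y => fderiv ℝ (fun y => φ t y * (ec i t y * ec j t y)) y (b j) * ⟪e t y, b i⟫ :=
        (hcont.comp (continuous_const.prodMk continuous_id)).mul
          ((he1 t).continuous.inner continuous_const)
      have hcB : Continuous fun y => (φ t y * (ec i t y * ec j t y)) * ⟪fderiv ℝ (e t) y (b j), b i⟫ :=
        hϑ1.continuous.mul ((((he1 t).continuous_fderiv one_ne_zero).clm_apply continuous_const).inner
          continuous_const)
      have iA : Integrable (fun y => fderiv ℝ (fun y => φ t y * (ec i t y * ec j t y)) y (b j) * ⟪e t y, b i⟫)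
          volume := hcA.integrable_of_hasCompactSupport ((hϑc.fderiv_apply (𝕜 := ℝ) (b j)).mul_right)
      have iB : Integrable (fun y => (φ t y * (ec i t y * ec j t y)) * ⟪fderiv ℝ (e t) y (b j), b i⟫)
          volume := hcB.integrable_of_hasCompactSupport hϑc.mul_right
      rw [integral_add iA iB] at h0
      linarith
    -- for `u`, from the weak gradient `G`
    have hU := hG.integral_fderiv_mul_inner_eq _ (hϑ i j) (b j) (b i)
    have iUu : Integrable (fun z : ℝ × E =>
        fderiv ℝ (fun y => φ z.1 y * (ec i z.1 y * ec j z.1 y)) z.2 (b j) * ⟪u z.1 z.2, b i⟫) volume := by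
      refine ((iUij i j).add iUe).congr (Eventually.of_forall fun z => ?_)
      simp only [Pi.add_apply, inner_sub_left]
      ring
    have iVu : Integrable (fun z : ℝ × E =>
        (φ z.1 z.2 * (ec i z.1 z.2 * ec j z.1 z.2)) * ⟪G z.1 z.2 (b j), b i⟫) volume := by
      refine ((iVij i j).add iVe).congr (Eventually.of_forall fun z => ?_)
      simp only [Pi.add_apply, _root_.sub_apply, inner_sub_left]
      ring
    have hU' : ∫ z : ℝ × E, fderiv ℝ (fun y => φ z.1 y * (ec i z.1 y * ec j z.1 y)) z.2 (b j) *
        ⟪u z.1 z.2, b i⟫ = -∫ z : ℝ × E, (φ z.1 z.2 * (ec i z.1 z.2 * ec j z.1 z.2)) * ⟪G z.1 z.2 (b j), b i⟫ := by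
      have h1 := integral_prod (μ := volume) (ν := volume) _ iUu
      have h2 := integral_prod (μ := volume) (ν := volume) _ iVu
      rw [← Measure.volume_eq_prod] at h1 h2
      rw [h1, h2]
      exact hU
    -- subtract
    have e1 : (fun z : ℝ × E => fderiv ℝ (fun y => φ z.1 y * (ec i z.1 y * ec j z.1 y)) z.2 (b j) *
        ⟪u z.1 z.2 - e z.1 z.2, b i⟫) = fun z : ℝ × E =>
        fderiv ℝ (fun y => φ z.1 y * (ec i z.1 y * ec j z.1 y)) z.2 (b j) * ⟪u z.1 z.2, b i⟫ -
        fderiv ℝ (fun y => φ z.1 y * (ec i z.1 y * ec j z.1 y)) z.2 (b j) * ⟪e z.1 z.2, b i⟫ := by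
      funext z; rw [inner_sub_left]; ring
    have e2 : (fun z : ℝ × E => (φ z.1 z.2 * (ec i z.1 z.2 * ec j z.1 z.2)) *
        ⟪(G z.1 z.2 - fderiv ℝ (e z.1) z.2) (b j), b i⟫) = fun z : ℝ × E =>
        (φ z.1 z.2 * (ec i z.1 z.2 * ec j z.1 z.2)) * ⟪G z.1 z.2 (b j), b i⟫ -
        (φ z.1 z.2 * (ec i z.1 z.2 * ec j z.1 z.2)) * ⟪fderiv ℝ (e z.1) z.2 (b j), b i⟫ := by
      funext z; rw [_root_.sub_apply, inner_sub_left]; ring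
    rw [e1, e2, integral_sub iUu iUe, integral_sub iVu iVe, hU', hE]
    ring
  -- sum over `i`, `j`
  have hsumW : ∫ z : ℝ × E, ∑ i, ∑ j, fderiv ℝ (fun y => φ z.1 y * (ec i z.1 y * ec j z.1 y)) z.2 (b j) *
      ⟪u z.1 z.2 - e z.1 z.2, b i⟫ = -∫ z : ℝ × E, ∑ i, ∑ j, (φ z.1 z.2 * (ec i z.1 z.2 * ec j z.1 z.2)) *
        ⟪(G z.1 z.2 - fderiv ℝ (e z.1) z.2) (b j), b i⟫ := by
    have iUi : ∀ i, Integrable (fun z : ℝ × E => ∑ j, fderiv ℝ (fun y => φ z.1 y * (ec i z.1 y * ec j z.1 y)) z.2 (b j) *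
        ⟪u z.1 z.2 - e z.1 z.2, b i⟫) volume := fun i => integrable_finsetSum _ fun j _ => iUij i j
    have iVi : ∀ i, Integrable (fun z : ℝ × E => ∑ j, (φ z.1 z.2 * (ec i z.1 z.2 * ec j z.1 z.2)) *
        ⟪(G z.1 z.2 - fderiv ℝ (e z.1) z.2) (b j), b i⟫) volume := fun i =>
      integrable_finsetSum _ fun j _ => iVij i j
    rw [integral_finsetSum _ fun i _ => iUi i, integral_finsetSum _ fun i _ => iVi i,
      ← Finset.sum_neg_distrib]
    refine Finset.sum_congr rfl fun i _ => ?_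
    rw [integral_finsetSum _ fun j _ => iUij i j, integral_finsetSum _ fun j _ => iVij i j,
      ← Finset.sum_neg_distrib]
    exact Finset.sum_congr rfl fun j _ => hWij i j
  -- pointwise evaluation of the sums
  have hrepr : ∀ z : ℝ × E, ∑ j, ec j z.1 z.2 • b j = e z.1 z.2 := fun z => by
    conv_rhs => rw [← b.sum_repr' (e z.1 z.2)]
    exact Finset.sum_congr rfl fun j _ => by simp only [hec, real_inner_comm (b j)]
  have hUsum : ∀ z : ℝ × E, ∑ i, ∑ j, fderiv ℝ (fun y => φ z.1 y * (ec i z.1 y * ec j z.1 y)) z.2 (b j) *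
      ⟪u z.1 z.2 - e z.1 z.2, b i⟫ =
      ⟪e z.1 z.2, gradient (φ z.1) z.2⟫ * ⟪e z.1 z.2, u z.1 z.2 - e z.1 z.2⟫ +
        φ z.1 z.2 * ⟪fderiv ℝ (e z.1) z.2 (e z.1 z.2), u z.1 z.2 - e z.1 z.2⟫ := by
    intro z
    set w : E := u z.1 z.2 - e z.1 z.2 with hw
    -- the three elementary sums
    have hs1 : ∑ i, ec i z.1 z.2 * ⟪w, b i⟫ = ⟪e z.1 z.2, w⟫ := by
      rw [← b.sum_inner_mul_inner (e z.1 z.2) w]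
      exact Finset.sum_congr rfl fun i _ => by simp only [hec, real_inner_comm (b i) w]
    have hs2 : ∑ j, fderiv ℝ (φ z.1) z.2 (b j) * ec j z.1 z.2 = ⟪e z.1 z.2, gradient (φ z.1) z.2⟫ := by
      have h1 : ∑ j, fderiv ℝ (φ z.1) z.2 (b j) * ec j z.1 z.2 = fderiv ℝ (φ z.1) z.2 (∑ j, ec j z.1 z.2 • b j) := by
        rw [map_sum]
        exact Finset.sum_congr rfl fun j _ => by rw [map_smul, smul_eq_mul, mul_comm]
      rw [h1, hrepr, real_inner_comm, gradient, InnerProductSpace.toDual_symm_apply]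
    have hs3 : ∀ j, ∑ i, ⟪fderiv ℝ (e z.1) z.2 (b j), b i⟫ * ⟪w, b i⟫ = ⟪fderiv ℝ (e z.1) z.2 (b j), w⟫ := by
      intro j
      rw [← b.sum_inner_mul_inner (fderiv ℝ (e z.1) z.2 (b j)) w]
      exact Finset.sum_congr rfl fun i _ => by rw [real_inner_comm (b i) w]
    have hs4 : ∑ j, ec j z.1 z.2 * ⟪fderiv ℝ (e z.1) z.2 (b j), w⟫ = ⟪fderiv ℝ (e z.1) z.2 (e z.1 z.2), w⟫ := by
      have h1 : ∑ j, ec j z.1 z.2 * ⟪fderiv ℝ (e z.1) z.2 (b j), w⟫ =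
          ⟪fderiv ℝ (e z.1) z.2 (∑ j, ec j z.1 z.2 • b j), w⟫ := by
        rw [map_sum, sum_inner]
        exact Finset.sum_congr rfl fun j _ => by rw [map_smul, real_inner_smul_left]
      rw [h1, hrepr]
    have hs5 : ∑ j, ⟪fderiv ℝ (e z.1) z.2 (b j), b j⟫ = 0 := by
      have := hdiv z.1 z.2
      rw [divergence_eq_sum_inner_fderiv b] at this
      rw [← this]
      exact Finset.sum_congr rfl fun j _ => by rw [real_inner_comm]
    -- expand
    have hexp : ∀ i j, fderiv ℝ (fun y => φ z.1 y * (ec i z.1 y * ec j z.1 y)) z.2 (b j) * ⟪w, b i⟫ =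
        (fderiv ℝ (φ z.1) z.2 (b j) * ec j z.1 z.2) * (ec i z.1 z.2 * ⟪w, b i⟫) +
        φ z.1 z.2 * (ec j z.1 z.2 * (⟪fderiv ℝ (e z.1) z.2 (b j), b i⟫ * ⟪w, b i⟫)) +
        φ z.1 z.2 * (⟪fderiv ℝ (e z.1) z.2 (b j), b j⟫ * (ec i z.1 z.2 * ⟪w, b i⟫)) := by
      intro i j
      rw [hdϑ i j z.1 z.2]
      ring
    simp only [hexp, Finset.sum_add_distrib, ← Finset.mul_sum, ← Finset.sum_mul]
    rw [Finset.sum_comm, hs1, hs2, hs5]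
    simp only [← Finset.mul_sum, hs3, hs4]
    ring
  have hVsum : ∀ z : ℝ × E, ∑ i, ∑ j, (φ z.1 z.2 * (ec i z.1 z.2 * ec j z.1 z.2)) *
      ⟪(G z.1 z.2 - fderiv ℝ (e z.1) z.2) (b j), b i⟫ =
      φ z.1 z.2 * ⟪(G z.1 z.2 - fderiv ℝ (e z.1) z.2) (e z.1 z.2), e z.1 z.2⟫ := by
    intro z
    set L : E →L[ℝ] E := G z.1 z.2 - fderiv ℝ (e z.1) z.2 with hL
    have hs1 : ∀ i, ∑ j, ec j z.1 z.2 * ⟪L (b j), b i⟫ = ⟪L (e z.1 z.2), b i⟫ := by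
      intro i
      have h1 : ∑ j, ec j z.1 z.2 * ⟪L (b j), b i⟫ = ⟪L (∑ j, ec j z.1 z.2 • b j), b i⟫ := by
        rw [map_sum, sum_inner]
        exact Finset.sum_congr rfl fun j _ => by rw [map_smul, real_inner_smul_left]
      rw [h1, hrepr]
    have hs2 : ∑ i, ec i z.1 z.2 * ⟪L (e z.1 z.2), b i⟫ = ⟪L (e z.1 z.2), e z.1 z.2⟫ := by
      rw [← b.sum_inner_mul_inner (L (e z.1 z.2)) (e z.1 z.2)]
      exact Finset.sum_congr rfl fun i _ => by simp only [hec, real_inner_comm (b i)]; ring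
    have hexp : ∀ i j, (φ z.1 z.2 * (ec i z.1 z.2 * ec j z.1 z.2)) * ⟪L (b j), b i⟫ =
        φ z.1 z.2 * (ec i z.1 z.2 * (ec j z.1 z.2 * ⟪L (b j), b i⟫)) := fun i j => by ring
    simp only [hexp, ← Finset.mul_sum, hs1, hs2]
  simp only [hUsum, hVsum] at hsumW
  -- integrability of the two sides and the identity (iii)
  have gW1 : IntegrableOn (fun z : ℝ × E => ‖u z.1 z.2 - e z.1 z.2‖) K volume :=
    Integrable.mono' (gU1.add (integrableOn_const (C := Ce) (hs := hKc.measure_lt_top.ne)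
      |>.integrable)) hwm'.norm ((ae_restrict_iff' hKm).2 (Eventually.of_forall fun z hz => by
        rw [norm_norm]; exact (norm_sub_le _ _).trans (add_le_add le_rfl (hCe z hz))))
  have i_egew : Integrable (fun z : ℝ × E =>
      ⟪e z.1 z.2, gradient (φ z.1) z.2⟫ * ⟪e z.1 z.2, u z.1 z.2 - e z.1 z.2⟫) volume := by
    refine integrable_of_bound_on_compact hKc (gW1.const_mul (Ce * Cgφ * Ce))
      ((he_c.inner hgφ_c).aestronglyMeasurable.mul (he_c.aestronglyMeasurable.inner hwm'))
      (fun z hz => by rw [hgφK z hz, inner_zero_right, zero_mul]) fun z hz => ?_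
    rw [norm_mul]
    calc ‖⟪e z.1 z.2, gradient (φ z.1) z.2⟫‖ * ‖⟪e z.1 z.2, u z.1 z.2 - e z.1 z.2⟫‖
        ≤ (Ce * Cgφ) * (Ce * ‖u z.1 z.2 - e z.1 z.2‖) :=
          mul_le_mul ((norm_inner_le_norm _ _).trans (mul_le_mul (hCe z hz) (hCgφ z hz) (norm_nonneg _)
            hCe0)) ((norm_inner_le_norm _ _).trans (mul_le_mul_of_nonneg_right (hCe z hz) (norm_nonneg _)))
            (norm_nonneg _) (by positivity)
      _ = Ce * Cgφ * Ce * ‖u z.1 z.2 - e z.1 z.2‖ := by ring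
  have hGwe_m : AEStronglyMeasurable (fun z : ℝ × E => (G z.1 z.2 - fderiv ℝ (e z.1) z.2) (e z.1 z.2))
      (volume.restrict K) :=
    (isBoundedBilinearMap_apply (𝕜 := ℝ) (E := E) (F := E)).continuous.comp_aestronglyMeasurable₂
      hGwm' he_c.aestronglyMeasurable
  -- Cauchy–Schwarz: `‖L v‖ ≤ |L|_F ‖v‖`
  have hCS : ∀ (L : E →L[ℝ] E) (v : E), ‖L v‖ ≤ Real.sqrt (frobeniusNormSq L) * ‖v‖ := by
    intro L v
    have hv : L v = ∑ i, ⟪b i, v⟫ • L (b i) := by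
      conv_lhs => rw [← b.sum_repr' v]
      simp [map_sum, map_smul]
    have hCS' := Finset.sum_mul_sq_le_sq_mul_sq Finset.univ (fun i => |⟪b i, v⟫|) (fun i => ‖L (b i)‖)
    have hpar : ∑ i, |⟪b i, v⟫| ^ 2 = ‖v‖ ^ 2 := by
      rw [← b.sum_sq_norm_inner_right v]
      simp [Real.norm_eq_abs]
    have hfrob : ∑ i, ‖L (b i)‖ ^ 2 = frobeniusNormSq L := (frobeniusNormSq_eq_sum b L).symm
    calc ‖L v‖ = ‖∑ i, ⟪b i, v⟫ • L (b i)‖ := by rw [hv]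
      _ ≤ ∑ i, ‖⟪b i, v⟫ • L (b i)‖ := norm_sum_le _ _
      _ = ∑ i, |⟪b i, v⟫| * ‖L (b i)‖ := by simp [norm_smul]
      _ ≤ Real.sqrt ((∑ i, |⟪b i, v⟫| ^ 2) * ∑ i, ‖L (b i)‖ ^ 2) :=
          (le_abs_self _).trans (Real.abs_le_sqrt hCS')
      _ = Real.sqrt (frobeniusNormSq L) * ‖v‖ := by
          rw [hpar, hfrob, mul_comm, Real.sqrt_mul (frobeniusNormSq_nonneg L), Real.sqrt_sq (norm_nonneg _)]
  have gGw2 : IntegrableOn (fun z : ℝ × E => frobeniusNormSq (G z.1 z.2 - fderiv ℝ (e z.1) z.2)) K volume := by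
    have h1 : IntegrableOn (fun z : ℝ × E => 2 * frobeniusNormSq (G z.1 z.2) + 2 * (Module.finrank ℝ E * CDe ^ 2))
        K volume := (gG2.const_mul 2).add (integrableOn_const (hs := hKc.measure_lt_top.ne)).integrable
    refine Integrable.mono' h1 (hfrob_c.comp_aestronglyMeasurable hGwm') ((ae_restrict_iff' hKm).2
      (Eventually.of_forall fun z hz => ?_))
    rw [Real.norm_eq_abs, abs_of_nonneg (frobeniusNormSq_nonneg _), frobeniusNormSq_eq_sum b,
      frobeniusNormSq_eq_sum b]
    have hi : ∀ i, ‖(G z.1 z.2 - fderiv ℝ (e z.1) z.2) (b i)‖ ^ 2 ≤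
        2 * ‖G z.1 z.2 (b i)‖ ^ 2 + 2 * CDe ^ 2 := by
      intro i
      have h3 : ‖fderiv ℝ (e z.1) z.2 (b i)‖ ≤ CDe :=
        (ContinuousLinearMap.le_opNorm _ _).trans (by rw [b.orthonormal.1 i, mul_one]; exact hCDe z hz)
      rw [_root_.sub_apply]
      calc ‖G z.1 z.2 (b i) - fderiv ℝ (e z.1) z.2 (b i)‖ ^ 2
          ≤ (‖G z.1 z.2 (b i)‖ + ‖fderiv ℝ (e z.1) z.2 (b i)‖) ^ 2 := by gcongr; exact norm_sub_le _ _
        _ ≤ 2 * ‖G z.1 z.2 (b i)‖ ^ 2 + 2 * ‖fderiv ℝ (e z.1) z.2 (b i)‖ ^ 2 := by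
            nlinarith [sq_nonneg (‖G z.1 z.2 (b i)‖ - ‖fderiv ℝ (e z.1) z.2 (b i)‖)]
        _ ≤ 2 * ‖G z.1 z.2 (b i)‖ ^ 2 + 2 * CDe ^ 2 := by nlinarith [norm_nonneg (fderiv ℝ (e z.1) z.2 (b i))]
    calc ∑ i, ‖(G z.1 z.2 - fderiv ℝ (e z.1) z.2) (b i)‖ ^ 2 ≤ ∑ i, (2 * ‖G z.1 z.2 (b i)‖ ^ 2 + 2 * CDe ^ 2) :=
          Finset.sum_le_sum fun i _ => hi i
      _ = 2 * ∑ i, ‖G z.1 z.2 (b i)‖ ^ 2 + 2 * (Module.finrank ℝ E * CDe ^ 2) := by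
          rw [Finset.sum_add_distrib, Finset.mul_sum, Finset.sum_const, Finset.card_univ,
            Fintype.card_fin, nsmul_eq_mul]
          ring
  have iGwee : Integrable (fun z : ℝ × E =>
      φ z.1 z.2 * ⟪(G z.1 z.2 - fderiv ℝ (e z.1) z.2) (e z.1 z.2), e z.1 z.2⟫) volume := by
    refine integrable_of_bound_on_compact hKc ((gGw2.add (integrableOn_const (C := (1 : ℝ))
      (hs := hKc.measure_lt_top.ne)).integrable).const_mul (Cφ * Ce ^ 2))
      (hφ_c.aestronglyMeasurable.mul (hGwe_m.inner he_c.aestronglyMeasurable))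
      (fun z hz => by rw [hφK z hz, zero_mul]) fun z hz => ?_
    rw [norm_mul]
    have h1 : ‖⟪(G z.1 z.2 - fderiv ℝ (e z.1) z.2) (e z.1 z.2), e z.1 z.2⟫‖ ≤
        Real.sqrt (frobeniusNormSq (G z.1 z.2 - fderiv ℝ (e z.1) z.2)) * Ce ^ 2 := by
      refine (norm_inner_le_norm _ _).trans ?_
      calc ‖(G z.1 z.2 - fderiv ℝ (e z.1) z.2) (e z.1 z.2)‖ * ‖e z.1 z.2‖
          ≤ (Real.sqrt (frobeniusNormSq (G z.1 z.2 - fderiv ℝ (e z.1) z.2)) * ‖e z.1 z.2‖) * ‖e z.1 z.2‖ :=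
            mul_le_mul_of_nonneg_right (hCS _ _) (norm_nonneg _)
        _ ≤ (Real.sqrt (frobeniusNormSq (G z.1 z.2 - fderiv ℝ (e z.1) z.2)) * Ce) * Ce :=
            mul_le_mul (mul_le_mul_of_nonneg_left (hCe z hz) (Real.sqrt_nonneg _)) (hCe z hz)
              (norm_nonneg _) (by positivity)
        _ = _ := by ring
    have h2 : Real.sqrt (frobeniusNormSq (G z.1 z.2 - fderiv ℝ (e z.1) z.2)) ≤
        frobeniusNormSq (G z.1 z.2 - fderiv ℝ (e z.1) z.2) + 1 := by
      nlinarith [Real.sq_sqrt (frobeniusNormSq_nonneg (G z.1 z.2 - fderiv ℝ (e z.1) z.2)),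
        Real.sqrt_nonneg (frobeniusNormSq (G z.1 z.2 - fderiv ℝ (e z.1) z.2)),
        sq_nonneg (Real.sqrt (frobeniusNormSq (G z.1 z.2 - fderiv ℝ (e z.1) z.2)) - 1)]
    calc ‖φ z.1 z.2‖ * ‖⟪(G z.1 z.2 - fderiv ℝ (e z.1) z.2) (e z.1 z.2), e z.1 z.2⟫‖
        ≤ Cφ * ((frobeniusNormSq (G z.1 z.2 - fderiv ℝ (e z.1) z.2) + 1) * Ce ^ 2) :=
          mul_le_mul (hCφ z hz) (h1.trans (mul_le_mul_of_nonneg_right h2 (by positivity))) (norm_nonneg _) hCφ0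
      _ = Cφ * Ce ^ 2 * (frobeniusNormSq (G z.1 z.2 - fderiv ℝ (e z.1) z.2) + 1) := by ring
  have hT2 : (∫ z : ℝ × E, ⟪e z.1 z.2, gradient (φ z.1) z.2⟫ * ⟪e z.1 z.2, u z.1 z.2 - e z.1 z.2⟫) +
      ∫ z : ℝ × E, φ z.1 z.2 * ⟪fderiv ℝ (e z.1) z.2 (e z.1 z.2), u z.1 z.2 - e z.1 z.2⟫ =
      -∫ z : ℝ × E, φ z.1 z.2 * ⟪(G z.1 z.2 - fderiv ℝ (e z.1) z.2) (e z.1 z.2), e z.1 z.2⟫ := by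
    rw [← integral_add i_egew iT2]
    exact hsumW
  -- ### (iv) Young and the bound on `⟪De(w), w⟫`
  have iGw : Integrable (fun z : ℝ × E => frobeniusNormSq (G z.1 z.2 - fderiv ℝ (e z.1) z.2) * φ z.1 z.2)
      volume := by
    refine integrable_of_bound_on_compact hKc (gGw2.mul_const Cφ)
      ((hfrob_c.comp_aestronglyMeasurable hGwm').mul hφ_c.aestronglyMeasurable)
      (fun z hz => by rw [hφK z hz, mul_zero]) fun z hz => ?_
    rw [norm_mul, Real.norm_eq_abs, abs_of_nonneg (frobeniusNormSq_nonneg _)]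
    exact mul_le_mul_of_nonneg_left (hCφ z hz) (frobeniusNormSq_nonneg _)
  have iE4 : Integrable (fun z : ℝ × E => φ z.1 z.2 * ‖e z.1 z.2‖ ^ 4) volume :=
    hint (hφ_c.mul (he_c.norm.pow 4)) fun z hz => by rw [hφK z hz, zero_mul]
  have hYoung : 2 * ∫ z : ℝ × E, φ z.1 z.2 * ⟪(G z.1 z.2 - fderiv ℝ (e z.1) z.2) (e z.1 z.2), e z.1 z.2⟫ ≤
      ν * (∫ z : ℝ × E, frobeniusNormSq (G z.1 z.2 - fderiv ℝ (e z.1) z.2) * φ z.1 z.2) +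
        1 / ν * ∫ z : ℝ × E, φ z.1 z.2 * ‖e z.1 z.2‖ ^ 4 := by
    rw [← integral_const_mul, ← integral_const_mul, ← integral_const_mul,
      ← integral_add (iGw.const_mul ν) (iE4.const_mul _)]
    refine integral_mono (iGwee.const_mul 2) ((iGw.const_mul ν).add (iE4.const_mul _)) fun z => ?_
    dsimp only
    set L : E →L[ℝ] E := G z.1 z.2 - fderiv ℝ (e z.1) z.2 with hL
    set a : ℝ := Real.sqrt (frobeniusNormSq L) with ha
    set c : ℝ := ‖e z.1 z.2‖ with hc
    have ha0 : 0 ≤ a := Real.sqrt_nonneg _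
    have ha2 : a ^ 2 = frobeniusNormSq L := Real.sq_sqrt (frobeniusNormSq_nonneg _)
    have h1 : ⟪L (e z.1 z.2), e z.1 z.2⟫ ≤ a * c ^ 2 := by
      calc ⟪L (e z.1 z.2), e z.1 z.2⟫ ≤ ‖L (e z.1 z.2)‖ * ‖e z.1 z.2‖ := real_inner_le_norm _ _
        _ ≤ (a * c) * c := mul_le_mul_of_nonneg_right (hCS L _) (norm_nonneg _)
        _ = a * c ^ 2 := by ring
    have h2 : 2 * (a * c ^ 2) ≤ ν * a ^ 2 + 1 / ν * c ^ 4 := by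
      have : ν * a ^ 2 + 1 / ν * c ^ 4 - 2 * (a * c ^ 2) = (ν * a - c ^ 2) ^ 2 / ν := by
        field_simp
        ring
      have h3 : 0 ≤ (ν * a - c ^ 2) ^ 2 / ν := div_nonneg (sq_nonneg _) hν.le
      linarith
    have hφz := hφ0 z.1 z.2
    calc 2 * (φ z.1 z.2 * ⟪L (e z.1 z.2), e z.1 z.2⟫) = φ z.1 z.2 * (2 * ⟪L (e z.1 z.2), e z.1 z.2⟫) := by ring
      _ ≤ φ z.1 z.2 * (ν * a ^ 2 + 1 / ν * c ^ 4) :=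
          mul_le_mul_of_nonneg_left (by linarith [mul_le_mul_of_nonneg_left h1 zero_le_two]) hφz
      _ = ν * (frobeniusNormSq L * φ z.1 z.2) + 1 / ν * (φ z.1 z.2 * c ^ 4) := by rw [← ha2]; ring
  have iDw : Integrable (fun z : ℝ × E => φ z.1 z.2 * (‖fderiv ℝ (e z.1) z.2‖ * ‖u z.1 z.2 - e z.1 z.2‖ ^ 2))
      volume := by
    refine integrable_of_bound_on_compact hKc (gW2.const_mul (Cφ * CDe))
      (hφ_c.aestronglyMeasurable.mul (hDe_c.norm.aestronglyMeasurable.mul (hwm'.norm.pow 2)))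
      (fun z hz => by rw [hφK z hz, zero_mul]) fun z hz => ?_
    rw [norm_mul, norm_mul, Real.norm_eq_abs, abs_of_nonneg (hφ0 z.1 z.2), norm_norm, Real.norm_eq_abs,
      abs_of_nonneg (sq_nonneg _)]
    calc φ z.1 z.2 * (‖fderiv ℝ (e z.1) z.2‖ * ‖u z.1 z.2 - e z.1 z.2‖ ^ 2)
        ≤ Cφ * (CDe * ‖u z.1 z.2 - e z.1 z.2‖ ^ 2) := by
          refine mul_le_mul ((le_abs_self _).trans ((Real.norm_eq_abs _).symm.le.trans (hCφ z hz)))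
            (mul_le_mul_of_nonneg_right (hCDe z hz) (sq_nonneg _)) (by positivity) hCφ0
      _ = Cφ * CDe * ‖u z.1 z.2 - e z.1 z.2‖ ^ 2 := by ring
  have hT1 : -(2 * ∫ z : ℝ × E, φ z.1 z.2 * ⟪fderiv ℝ (e z.1) z.2 (u z.1 z.2 - e z.1 z.2), u z.1 z.2 - e z.1 z.2⟫) ≤
      2 * ∫ z : ℝ × E, φ z.1 z.2 * (‖fderiv ℝ (e z.1) z.2‖ * ‖u z.1 z.2 - e z.1 z.2‖ ^ 2) := by
    rw [← integral_const_mul, ← integral_neg, ← integral_const_mul]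
    refine integral_mono (iT1.const_mul 2).fun_neg (iDw.const_mul 2) fun z => ?_
    dsimp only
    have hφz := hφ0 z.1 z.2
    have h1 : -⟪fderiv ℝ (e z.1) z.2 (u z.1 z.2 - e z.1 z.2), u z.1 z.2 - e z.1 z.2⟫ ≤
        ‖fderiv ℝ (e z.1) z.2‖ * ‖u z.1 z.2 - e z.1 z.2‖ ^ 2 := by
      calc -⟪fderiv ℝ (e z.1) z.2 (u z.1 z.2 - e z.1 z.2), u z.1 z.2 - e z.1 z.2⟫
          ≤ ‖⟪fderiv ℝ (e z.1) z.2 (u z.1 z.2 - e z.1 z.2), u z.1 z.2 - e z.1 z.2⟫‖ :=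
            (neg_le_abs _).trans (Real.norm_eq_abs _).symm.le
        _ ≤ ‖fderiv ℝ (e z.1) z.2 (u z.1 z.2 - e z.1 z.2)‖ * ‖u z.1 z.2 - e z.1 z.2‖ := norm_inner_le_norm _ _
        _ ≤ (‖fderiv ℝ (e z.1) z.2‖ * ‖u z.1 z.2 - e z.1 z.2‖) * ‖u z.1 z.2 - e z.1 z.2‖ :=
            mul_le_mul_of_nonneg_right (ContinuousLinearMap.le_opNorm _ _) (norm_nonneg _)
        _ = _ := by ring
    calc -(2 * (φ z.1 z.2 * ⟪fderiv ℝ (e z.1) z.2 (u z.1 z.2 - e z.1 z.2), u z.1 z.2 - e z.1 z.2⟫))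
        = 2 * (φ z.1 z.2 * -⟪fderiv ℝ (e z.1) z.2 (u z.1 z.2 - e z.1 z.2), u z.1 z.2 - e z.1 z.2⟫) := by ring
      _ ≤ 2 * (φ z.1 z.2 * (‖fderiv ℝ (e z.1) z.2‖ * ‖u z.1 z.2 - e z.1 z.2‖ ^ 2)) := by
          gcongr
  -- ### (v) conclusion: the product integrals in iterated form
  have i_e2w : Integrable (fun z : ℝ × E => ‖e z.1 z.2‖ ^ 2 * ⟪u z.1 z.2 - e z.1 z.2, gradient (φ z.1) z.2⟫)
      volume := by
    refine integrable_of_bound_on_compact hKc (gW1.const_mul (Ce ^ 2 * Cgφ))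
      ((he_c.norm.pow 2).aestronglyMeasurable.mul (hwm'.inner hgφ_c.aestronglyMeasurable))
      (fun z hz => by rw [hgφK z hz, inner_zero_right, mul_zero]) fun z hz => ?_
    rw [norm_mul, Real.norm_eq_abs, abs_of_nonneg (sq_nonneg _)]
    calc ‖e z.1 z.2‖ ^ 2 * ‖⟪u z.1 z.2 - e z.1 z.2, gradient (φ z.1) z.2⟫‖
        ≤ Ce ^ 2 * (‖u z.1 z.2 - e z.1 z.2‖ * Cgφ) :=
          mul_le_mul (pow_le_pow_left₀ (norm_nonneg _) (hCe z hz) 2) ((norm_inner_le_norm _ _).trans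
            (mul_le_mul_of_nonneg_left (hCgφ z hz) (norm_nonneg _))) (norm_nonneg _) (by positivity)
      _ = Ce ^ 2 * Cgφ * ‖u z.1 z.2 - e z.1 z.2‖ := by ring
  have i_ege2 : Integrable (fun z : ℝ × E => ⟪e z.1 z.2, gradient (φ z.1) z.2⟫ * ‖e z.1 z.2‖ ^ 2) volume :=
    hint ((he_c.inner hgφ_c).mul (he_c.norm.pow 2)) fun z hz => by rw [hgφK z hz, inner_zero_right, zero_mul]
  have c1 : ∫ t, ∫ x, φ t x * (‖fderiv ℝ (e t) x‖ * ‖u t x - e t x‖ ^ 2) =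
      ∫ z : ℝ × E, φ z.1 z.2 * (‖fderiv ℝ (e z.1) z.2‖ * ‖u z.1 z.2 - e z.1 z.2‖ ^ 2) :=
    (integral_prod (μ := volume) (ν := volume) _ iDw).symm
  have c2 : ∫ t, ∫ x, φ t x * ‖e t x‖ ^ 4 = ∫ z : ℝ × E, φ z.1 z.2 * ‖e z.1 z.2‖ ^ 4 :=
    (integral_prod (μ := volume) (ν := volume) _ iE4).symm
  have c3 : ∫ t, ∫ x, ‖e t x‖ ^ 2 * ⟪u t x - e t x, gradient (φ t) x⟫ =
      ∫ z : ℝ × E, ‖e z.1 z.2‖ ^ 2 * ⟪u z.1 z.2 - e z.1 z.2, gradient (φ z.1) z.2⟫ :=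
    (integral_prod (μ := volume) (ν := volume) _ i_e2w).symm
  have c4 : ∫ t, ∫ x, ⟪e t x, gradient (φ t) x⟫ * ⟪e t x, u t x - e t x⟫ =
      ∫ z : ℝ × E, ⟪e z.1 z.2, gradient (φ z.1) z.2⟫ * ⟪e z.1 z.2, u z.1 z.2 - e z.1 z.2⟫ :=
    (integral_prod (μ := volume) (ν := volume) _ i_egew).symm
  have c5 : ∫ t, ∫ x, ⟪e t x, gradient (φ t) x⟫ * ‖e t x‖ ^ 2 =
      ∫ z : ℝ × E, ⟪e z.1 z.2, gradient (φ z.1) z.2⟫ * ‖e z.1 z.2‖ ^ 2 :=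
    (integral_prod (μ := volume) (ν := volume) _ i_ege2).symm
  have c6 : ∫ t, ∫ x, frobeniusNormSq (G t x - fderiv ℝ (e t) x) * φ t x =
      ∫ z : ℝ × E, frobeniusNormSq (G z.1 z.2 - fderiv ℝ (e z.1) z.2) * φ z.1 z.2 :=
    (integral_prod (μ := volume) (ν := volume) _ iGw).symm
  rw [c1, c2, c3, c4, c5, c6]
  rw [c6, hP3] at h4
  linarith [h4, hD2, hD3, hT2, hYoung, hT1]

end Main

end Literature.Analysis.FluidPDE
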